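import Literature.Computability.Complexity.HardcoreInapproximabilityProofs
import HarnessLib

/-!
# The hard-core model on the complete `(d-1)`-ary tree with a boundary condition: recursions,
# contraction, envelopes, and the two-cycle (Sly 2010, §4) — Part I: vocabulary and basic theory

Sly 2010 (*Computational transition at the uniqueness threshold*, FOCS 2010), §4 "Reconstruction on
the tree", analyses the hard-core measure on the `(d-1)`-ary trees of depth `2⌊(ψ/2) log_{d-1} n⌋`
that his gadget `G(n, θ, ψ)` hangs onto the vertices `U` of the core `G̃` (see
`HardcoreInapproximabilityGadget.lean` for the deterministic construction and the cut at `U`). This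
file vendors the vocabulary and the DETERMINISTIC tree-side ingredients of that analysis, for the
complete `q`-ary tree of depth `L` (`q = d - 1`) with an arbitrary `0/1` boundary condition `A` on its
`q^L` leaves, the leaves being numbered so that the `c`-th child of the root owns the block
`[c q^{L-1}, (c+1) q^{L-1})` (`hcBlock`, `hcBlockConfig`, `hcSubConfig`):

* the partition functions `hcTreeZ q λ L r A` (root state `r`, weights `λ^{#occupied internal}`), the
  root marginal given the leaves `hcTreeX` (Sly's `X_{v,ℓ,s} = h^s_{v,ℓ}(A)`), the one-step map
  `hcStep` = `Φ(x) = λΠ(1-x_c)/(1+λΠ(1-x_c))` and **Sly's recursion (e:treeRecursionNoTilde)**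
  `X_{L+1}(A) = Φ((X_L(A|_c))_c)` (`hcTreeX_succ`), its depth-`L` aggregation `hcIter` (Sly's `g`) with
  `X_L(A) = g(𝟙_A)` and the **composition** `X_{K+L}(A) = g((X_K(A|_u))_u)` (`hcTreeX_add`);
* **the contraction step of Lemma 4.2 as printed**: `α/(1+α/3)² ≤ 3/4` (`abs_inv_sub_inv_le`), `Φ` is
  `3/4`-Lipschitz in `ℓ¹` on `[0, 2/3]^q` (`hcStep_lipschitz`), hence `g` contracts by `(3/4)^L`
  (`hcIter_contract`) and **(e:onePointCorrelations)** (`hcTreeX_contract`, `hcGood_subtree`);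
* **the sandwich between extreme boundary conditions**: `Φ` is antitone, so inputs in `[a,b]` give
  `g ∈ [lo_L, up_L]` with the envelopes `hcEnv` (`hcIter_mem_env`); from `(a,b) = (0,1)` the envelopes
  `m_k = hcm`, `M_k = hcM` enclose the two-cycle `q⁻ < q⁺` (`hcEnv_encloses`), are monotone along each
  parity (`hcEnv_monotone`) and **converge to `(q⁻, q⁺)`** (`hcEnv_eventually`, Sly's
  "`X_{v,ℓ,s} < q⁺ + δ` for `ℓ > ℓ'(d,λ,δ)`"), the limit being identified by Kelly's uniqueness of the
  two-cycle (`hardCore_treeTwoCycle_unique`; `eq_qp_of_period_two`, `eq_qm_of_period_two`);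
* **strict attraction of the two-cycle**: `(d-1)² q⁺q⁻ < 1` (`twoCycle_multiplier_lt_one`: in Kelly's
  parametrisation `q⁻ = 1/(1+r+⋯+r^{d-2})`, `q⁺ = r^{d-2} q⁻`, and `(d-1)² r^{d-2} < (Σ_{i<d-1} r^i)²`
  is the STRICT AM–GM inequality `sq_mul_pow_lt_geom_sum_sq`), whence Sly's extra condition
  `(d-1) q⁺q⁻ < 1` (e:extraConditions) for ALL `λ > λ_c` (`sly_extraCondition`);
* **the i.i.d. boundary field of fugacity `w`** (the projections of `μ̂^{±}`, Sly's Lemma 4.3): the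
  generating sums `hcGen q λ w L r = Σ_A w^{|A|} Z_L(r, A)` satisfy `G_{L+1}(1) = λ G_L(0)^q`,
  `G_{L+1}(0) = (G_L(0)+G_L(1))^q` (`hcGen_succ_true/false`, via the block factorisation
  `sum_prod_hcBlockConfig`), so the mean root marginal is `φ^L(w/(1+w))` (`hcGen_ratio`), and since
  every `X_L(A)` lies below `M_L`, **`E_ν|X_L - φ^L(w/(1+w))| ≤ 2(M_L - φ^L(w/(1+w)))`**
  (`hcTreeX_meanAbsDev_le`, from `sum_abs_sub_mean_le`) — a finite-volume substitute for the
  non-reconstruction input (e:extremalConvergence)/(e:treeReconDecay2) of Sly's §4;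
* vocabulary for the sequel `HardcoreInapproximabilityTreesConc.lean` (logit contraction, Markov cut,
  Chernoff bounds and Lemma 4.2 for all `λ`): the logit `hcLogit`, the subtree split
  `hcSubEquiv`/`hcSubConfigEquiv` with `sum_prod_hcSubConfig`, `hcLeafCount_sub`, and the window
  Lipschitz constants `hcΛ` of `φ` (`hcΛ_diag`: `Λ(y,y) = q φ(y)(1-φ(y))/(1-y)`).

No `Prop`-valued definitions.

## References

* A. Sly, *Computational transition at the uniqueness threshold*, FOCS 2010, arXiv:1005.5584: §1.3
  (the densities `q^{±}`, (e:pqRelation), (e:extraConditions)), §4 (eqs. (e:treeRecursionNoTilde),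
  (e:onePointCorrelations), (e:treeReconDecay2), (e:extremalConvergence); Lemma 4.2 and its proof),
  §4.1 (Lemma 4.3, the measure `P*`) [Sly2010].
* F. P. Kelly, *Stochastic models of computer communication systems*, J. Roy. Statist. Soc. B 47
  (1985) — uniqueness of the two-cycle (used through `hardCore_treeTwoCycle_unique`; quoted from Sly §1.3).
-/

namespace Literature.Computability.Complexity

open Finset

section TreeRecursion

/-- The `i`-th leaf of the `c`-th child block: leaves of the complete `q`-ary tree of depth `L + 1`
are numbered so that the subtree of the `c`-th child of the root owns the block
`[c q^L, (c+1) q^L)`. [folklore] -/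
def hcBlock (q L : ℕ) (c : Fin q) (i : Fin (q ^ L)) : Fin (q ^ (L + 1)) :=
  ⟨c * q ^ L + i, by
    have hi := i.isLt
    have hc := c.isLt
    calc (c : ℕ) * q ^ L + i < c * q ^ L + q ^ L := by omega
      _ = (c + 1) * q ^ L := by ring
      _ ≤ q * q ^ L := Nat.mul_le_mul_right _ hc
      _ = q ^ (L + 1) := (pow_succ' q L).symm⟩

/-- The leaf configuration seen by the `c`-th child. [folklore] -/
def hcBlockConfig {q L : ℕ} {β : Type*} (A : Fin (q ^ (L + 1)) → β) (c : Fin q) : Fin (q ^ L) → β :=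
  fun i => A (hcBlock q L c i)

/-- **Hard-core partition functions of the complete `q`-ary tree of depth `L` with boundary
condition `A` on the `q^L` leaves and prescribed root state `r`**: the total weight
`λ^{#occupied internal vertices}` (internal = non-leaf, the root included when `L ≥ 1`) of the
independent sets that agree with `A` on the leaves and have root state `r`; by recursion over the
`q` subtrees of the children ("the standard tree recursion for Gibbs measures of the hardcore
model"). At depth `0` the root is the unique leaf. [cite: Sly2010, §4 (proof of Lemma 4.2, eq. (e:treeRecursionNoTilde)); §4.1 (`κ(η)`)] -/
noncomputable def hcTreeZ (q : ℕ) (lam : ℝ) : (L : ℕ) → Bool → (Fin (q ^ L) → Bool) → ℝ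
  | 0, r, A => if A ⟨0, by simp⟩ = r then 1 else 0
  | L + 1, true, A => lam * ∏ c : Fin q, hcTreeZ q lam L false (hcBlockConfig A c)
  | L + 1, false, A => ∏ c : Fin q, (hcTreeZ q lam L false (hcBlockConfig A c) + hcTreeZ q lam L true (hcBlockConfig A c))

/-- The total weight `Z_L(A) = Z_L(0, A) + Z_L(1, A)` of the independent sets compatible with the
boundary condition `A`. [folklore] -/
noncomputable def hcTreeZtot (q : ℕ) (lam : ℝ) (L : ℕ) (A : Fin (q ^ L) → Bool) : ℝ :=
  hcTreeZ q lam L false A + hcTreeZ q lam L true A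

/-- **The root marginal given the leaves**, `X_L(A) = Z_L(1, A)/Z_L(A)` (Sly's `X_{v,ℓ,s}` evaluated at
the boundary configuration `A`; his `h^s_{v,ℓ}(A)`). [cite: Sly2010, §4 (definition of `h^s_{v,ℓ}`, `X_{v,ℓ,s}`)] -/
noncomputable def hcTreeX (q : ℕ) (lam : ℝ) (L : ℕ) (A : Fin (q ^ L) → Bool) : ℝ :=
  hcTreeZ q lam L true A / hcTreeZtot q lam L A

/-- **One step of the hard-core recursion**: `Φ(x) = λ Π_c (1 - x_c) / (1 + λ Π_c (1 - x_c))`.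
[cite: Sly2010, §4, eq. (e:treeRecursionNoTilde)] -/
noncomputable def hcStep (q : ℕ) (lam : ℝ) (x : Fin q → ℝ) : ℝ :=
  (lam * ∏ c, (1 - x c)) / (1 + lam * ∏ c, (1 - x c))

variable {q : ℕ} {lam : ℝ}

/-- Unfolding `Z_0`: the root is the leaf. [folklore] -/
theorem hcTreeZ_zero (r : Bool) (A : Fin (q ^ 0) → Bool) :
    hcTreeZ q lam 0 r A = if A ⟨0, by simp⟩ = r then 1 else 0 := rfl

/-- Unfolding `Z_{L+1}(1, ·)`: an occupied root forces unoccupied children. [cite: Sly2010, §4 (tree recursions)] -/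
theorem hcTreeZ_succ_true (L : ℕ) (A : Fin (q ^ (L + 1)) → Bool) :
    hcTreeZ q lam (L + 1) true A = lam * ∏ c : Fin q, hcTreeZ q lam L false (hcBlockConfig A c) := rfl

/-- Unfolding `Z_{L+1}(0, ·)`: an unoccupied root leaves the children free. [cite: Sly2010, §4 (tree recursions)] -/
theorem hcTreeZ_succ_false (L : ℕ) (A : Fin (q ^ (L + 1)) → Bool) :
    hcTreeZ q lam (L + 1) false A = ∏ c : Fin q, hcTreeZtot q lam L (hcBlockConfig A c) := rfl

/-- Nonnegativity of the partition functions (`λ ≥ 0`). [folklore] -/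
theorem hcTreeZ_nonneg (hlam : 0 ≤ lam) : ∀ (L : ℕ) (r : Bool) (A : Fin (q ^ L) → Bool),
    0 ≤ hcTreeZ q lam L r A
  | 0, r, A => by rw [hcTreeZ_zero]; split_ifs <;> norm_num
  | L + 1, true, A => by
    rw [hcTreeZ_succ_true]
    exact mul_nonneg hlam (prod_nonneg fun c _ => hcTreeZ_nonneg hlam L false _)
  | L + 1, false, A => by
    rw [hcTreeZ_succ_false]
    exact prod_nonneg fun c _ => add_nonneg (hcTreeZ_nonneg hlam L false _) (hcTreeZ_nonneg hlam L true _)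

/-- The total weight is positive (`λ ≥ 0`): some independent set is always compatible. [folklore] -/
theorem hcTreeZtot_pos (hlam : 0 ≤ lam) : ∀ (L : ℕ) (A : Fin (q ^ L) → Bool), 0 < hcTreeZtot q lam L A
  | 0, A => by
    unfold hcTreeZtot
    rw [hcTreeZ_zero, hcTreeZ_zero]
    cases A ⟨0, by simp⟩ <;> simp
  | L + 1, A => by
    unfold hcTreeZtot
    rw [hcTreeZ_succ_false]
    exact add_pos_of_pos_of_nonneg (prod_pos fun c _ => hcTreeZtot_pos hlam L _)
      (hcTreeZ_nonneg hlam (L + 1) true A)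

/-- `0 ≤ X_L(A) ≤ 1`. [folklore] -/
theorem hcTreeX_mem_Icc (hlam : 0 ≤ lam) (L : ℕ) (A : Fin (q ^ L) → Bool) :
    hcTreeX q lam L A ∈ Set.Icc (0 : ℝ) 1 := by
  unfold hcTreeX
  have hpos := hcTreeZtot_pos hlam L A (q := q)
  refine ⟨div_nonneg (hcTreeZ_nonneg hlam L true A) hpos.le, ?_⟩
  rw [div_le_one hpos]
  unfold hcTreeZtot
  linarith [hcTreeZ_nonneg hlam L false A (q := q)]

/-- `1 - X_L(A) = Z_L(0, A)/Z_L(A)`. [folklore] -/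
theorem one_sub_hcTreeX (hlam : 0 ≤ lam) (L : ℕ) (A : Fin (q ^ L) → Bool) :
    1 - hcTreeX q lam L A = hcTreeZ q lam L false A / hcTreeZtot q lam L A := by
  unfold hcTreeX
  have hpos := hcTreeZtot_pos hlam L A (q := q)
  field_simp
  unfold hcTreeZtot
  ring

/-- **Sly's recursion (e:treeRecursionNoTilde)**: `X_{L+1}(A) = Φ((X_L(A|_c))_c)`, i.e.
`X_v = λ Π_i (1 - X_{v_i}) / (1 + λ Π_i (1 - X_{v_i}))` over the children `v_i` of `v`.
[cite: Sly2010, §4 (proof of Lemma 4.2, eq. (e:treeRecursionNoTilde))] -/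
theorem hcTreeX_succ (hlam : 0 ≤ lam) (L : ℕ) (A : Fin (q ^ (L + 1)) → Bool) :
    hcTreeX q lam (L + 1) A = hcStep q lam fun c => hcTreeX q lam L (hcBlockConfig A c) := by
  unfold hcStep
  simp_rw [one_sub_hcTreeX hlam]
  rw [Finset.prod_div_distrib]
  have hP : 0 < ∏ c : Fin q, hcTreeZtot q lam L (hcBlockConfig A c) := prod_pos fun c _ => hcTreeZtot_pos hlam L _
  have hP' : (∏ c : Fin q, (hcTreeZ q lam L false (hcBlockConfig A c) + hcTreeZ q lam L true (hcBlockConfig A c))) ≠ 0 :=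
    hP.ne'
  have hT := hcTreeZtot_pos hlam (L + 1) A (q := q)
  unfold hcTreeX
  unfold hcTreeZtot at hT ⊢
  rw [hcTreeZ_succ_true, hcTreeZ_succ_false] at hT ⊢
  unfold hcTreeZtot at hT ⊢
  have hZf : 0 ≤ lam * ∏ c : Fin q, hcTreeZ q lam L false (hcBlockConfig A c) :=
    mul_nonneg hlam (prod_nonneg fun c _ => hcTreeZ_nonneg hlam L false _)
  have hden : 1 + lam * ((∏ c : Fin q, hcTreeZ q lam L false (hcBlockConfig A c)) /
      ∏ c : Fin q, (hcTreeZ q lam L false (hcBlockConfig A c) + hcTreeZ q lam L true (hcBlockConfig A c))) ≠ 0 := by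
    have : 0 ≤ lam * ((∏ c : Fin q, hcTreeZ q lam L false (hcBlockConfig A c)) /
        ∏ c : Fin q, (hcTreeZ q lam L false (hcBlockConfig A c) + hcTreeZ q lam L true (hcBlockConfig A c))) :=
      mul_nonneg hlam (div_nonneg (prod_nonneg fun c _ => hcTreeZ_nonneg hlam L false _) hP.le)
    linarith
  rw [div_eq_div_iff hT.ne' hden]
  field_simp

/-! #### The one-step map: range, antitonicity, and the Lipschitz bound `3/4` -/

/-- `Φ(x) = 1 - 1/(1 + λ Π (1 - x_c))`. [folklore] -/
theorem hcStep_eq (x : Fin q → ℝ) (h : 0 < 1 + lam * ∏ c, (1 - x c)) :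
    hcStep q lam x = 1 - 1 / (1 + lam * ∏ c, (1 - x c)) := by
  unfold hcStep
  field_simp
  ring

/-- The key numerical inequality of Sly's contraction step: for `α ≥ 0` and `t, t' ≥ 1/3`,
`|1/(1+αt) - 1/(1+αt')| ≤ (3/4)|t - t'|` ("`α/(1+α/3)² ≤ 3/4` by a simple optimization").
[cite: Sly2010, §4 (proof of Lemma 4.2)] -/
theorem abs_inv_sub_inv_le {α t t' : ℝ} (hα : 0 ≤ α) (ht : 1 / 3 ≤ t) (ht' : 1 / 3 ≤ t') :
    |1 / (1 + α * t) - 1 / (1 + α * t')| ≤ 3 / 4 * |t - t'| := by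
  have h1 : 0 < 1 + α * t := by positivity
  have h2 : 0 < 1 + α * t' := by positivity
  have hkey : α / ((1 + α * t) * (1 + α * t')) ≤ 3 / 4 := by
    rw [div_le_iff₀ (mul_pos h1 h2)]
    have h3 : 1 + α * (1 / 3) ≤ 1 + α * t := by nlinarith
    have h4 : 1 + α * (1 / 3) ≤ 1 + α * t' := by nlinarith
    have h5 : (1 + α * (1 / 3)) * (1 + α * (1 / 3)) ≤ (1 + α * t) * (1 + α * t') :=
      mul_le_mul h3 h4 (by positivity) h1.le
    nlinarith [sq_nonneg (α - 3)]
  rw [div_sub_div _ _ h1.ne' h2.ne', abs_div, abs_of_pos (mul_pos h1 h2)]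
  have : |1 * (1 + α * t') - (1 + α * t) * 1| = α * |t - t'| := by
    rw [show 1 * (1 + α * t') - (1 + α * t) * 1 = α * (t' - t) by ring, abs_mul, abs_of_nonneg hα,
      abs_sub_comm]
  rw [this]
  calc α * |t - t'| / ((1 + α * t) * (1 + α * t'))
      = |t - t'| * (α / ((1 + α * t) * (1 + α * t'))) := by ring
    _ ≤ |t - t'| * (3 / 4) := mul_le_mul_of_nonneg_left hkey (abs_nonneg _)
    _ = 3 / 4 * |t - t'| := by ring

/-- **One step of the recursion is `3/4`-Lipschitz in `ℓ¹`** when all inputs satisfy `1 - x ≥ 1/3`: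
`|Φ(x) - Φ(x')| ≤ (3/4) Σ_c |x_c - x'_c|` (changing one coordinate at a time).
[cite: Sly2010, §4 (proof of Lemma 4.2: "`|g(𝒳_{1,ℓ,s}) - g(𝒳'_{1,ℓ,s})| ≤ (3/4)|X_{u,ℓ-1,s} - X'_{u,ℓ-1,s}|`")] -/
theorem abs_inv_prod_sub_le : ∀ (q : ℕ) {lam : ℝ} (_ : 0 ≤ lam) (t t' : Fin q → ℝ)
    (_ : ∀ c, 1 / 3 ≤ t c) (_ : ∀ c, t c ≤ 1) (_ : ∀ c, 1 / 3 ≤ t' c) (_ : ∀ c, t' c ≤ 1),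
    |1 / (1 + lam * ∏ c, t c) - 1 / (1 + lam * ∏ c, t' c)| ≤ 3 / 4 * ∑ c, |t c - t' c|
  | 0, lam, hlam, t, t', _, _, _, _ => by simp
  | q + 1, lam, hlam, t, t', ht, ht1, ht', ht1' => by
    rw [Fin.prod_univ_succ, Fin.prod_univ_succ, Fin.sum_univ_succ]
    set R : ℝ := ∏ i : Fin q, t i.succ with hR
    set R' : ℝ := ∏ i : Fin q, t' i.succ with hR'
    have hR0 : 0 ≤ R := prod_nonneg fun i _ => by linarith [ht i.succ]
    have ht0' : 0 ≤ t' 0 := by linarith [ht' 0]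
    -- change the first coordinate, then the rest
    have step1 : |1 / (1 + lam * (t 0 * R)) - 1 / (1 + lam * (t' 0 * R))| ≤ 3 / 4 * |t 0 - t' 0| := by
      have := abs_inv_sub_inv_le (α := lam * R) (mul_nonneg hlam hR0) (ht 0) (ht' 0)
      convert this using 3 <;> ring
    have step2 : |1 / (1 + lam * (t' 0 * R)) - 1 / (1 + lam * (t' 0 * R'))| ≤
        3 / 4 * ∑ i : Fin q, |t i.succ - t' i.succ| := by
      have := abs_inv_prod_sub_le q (lam := lam * t' 0) (mul_nonneg hlam ht0') (fun i => t i.succ)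
        (fun i => t' i.succ) (fun i => ht _) (fun i => ht1 _) (fun i => ht' _) (fun i => ht1' _)
      convert this using 3 <;> simp [hR, hR'] <;> ring
    calc |1 / (1 + lam * (t 0 * R)) - 1 / (1 + lam * (t' 0 * R'))|
        ≤ |1 / (1 + lam * (t 0 * R)) - 1 / (1 + lam * (t' 0 * R))| +
            |1 / (1 + lam * (t' 0 * R)) - 1 / (1 + lam * (t' 0 * R'))| := abs_sub_le _ _ _
      _ ≤ 3 / 4 * |t 0 - t' 0| + 3 / 4 * ∑ i : Fin q, |t i.succ - t' i.succ| := add_le_add step1 step2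
      _ = 3 / 4 * (|t 0 - t' 0| + ∑ i : Fin q, |t i.succ - t' i.succ|) := by ring

/-- **`|Φ(x) - Φ(x')| ≤ (3/4) Σ_c |x_c - x'_c|`** for `x, x' ∈ [0, 2/3]^q` and `λ ≥ 0`.
[cite: Sly2010, §4 (proof of Lemma 4.2)] -/
theorem hcStep_lipschitz (hlam : 0 ≤ lam) (x x' : Fin q → ℝ) (hx0 : ∀ c, 0 ≤ x c) (hx : ∀ c, x c ≤ 2 / 3)
    (hx0' : ∀ c, 0 ≤ x' c) (hx' : ∀ c, x' c ≤ 2 / 3) :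
    |hcStep q lam x - hcStep q lam x'| ≤ 3 / 4 * ∑ c, |x c - x' c| := by
  have hP : 0 ≤ lam * ∏ c, (1 - x c) := mul_nonneg hlam (prod_nonneg fun c _ => by linarith [hx c])
  have hP' : 0 ≤ lam * ∏ c, (1 - x' c) := mul_nonneg hlam (prod_nonneg fun c _ => by linarith [hx' c])
  rw [hcStep_eq x (by linarith), hcStep_eq x' (by linarith)]
  rw [show (1 : ℝ) - 1 / (1 + lam * ∏ c, (1 - x c)) - (1 - 1 / (1 + lam * ∏ c, (1 - x' c))) =
    1 / (1 + lam * ∏ c, (1 - x' c)) - 1 / (1 + lam * ∏ c, (1 - x c)) by ring]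
  have h := abs_inv_prod_sub_le q hlam (fun c => 1 - x' c) (fun c => 1 - x c)
    (fun c => by linarith [hx' c]) (fun c => by linarith [hx0' c]) (fun c => by linarith [hx c])
    (fun c => by linarith [hx0 c])
  refine h.trans (le_of_eq ?_)
  congr 1
  refine sum_congr rfl fun c _ => ?_
  rw [show (1 : ℝ) - x' c - (1 - x c) = x c - x' c by ring]

/-- `Φ` is antitone in each coordinate on `[0,1]^q` (`λ ≥ 0`): raising the children's occupation
probabilities lowers the parent's. [folklore] -/
theorem hcStep_antitone (hlam : 0 ≤ lam) {x x' : Fin q → ℝ} (hxx' : ∀ c, x c ≤ x' c)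
    (hx' : ∀ c, x' c ≤ 1) : hcStep q lam x' ≤ hcStep q lam x := by
  have hP' : 0 ≤ ∏ c, (1 - x' c) := prod_nonneg fun c _ => by linarith [hx' c]
  have hPP : ∏ c, (1 - x' c) ≤ ∏ c, (1 - x c) :=
    prod_le_prod (fun c _ => by linarith [hx' c]) fun c _ => by linarith [hxx' c]
  have hP : 0 ≤ ∏ c, (1 - x c) := hP'.trans hPP
  unfold hcStep
  rw [div_le_div_iff₀ (by positivity) (by positivity)]
  nlinarith [mul_le_mul_of_nonneg_left hPP hlam]

/-- `0 ≤ Φ(x) < 1` on `[0,1]^q` (indeed `Φ ≤ λ/(1+λ)`). [folklore] -/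
theorem hcStep_mem_Ico (hlam : 0 ≤ lam) {x : Fin q → ℝ} (hx : ∀ c, x c ≤ 1) :
    hcStep q lam x ∈ Set.Ico (0 : ℝ) 1 := by
  have hP : 0 ≤ lam * ∏ c, (1 - x c) := mul_nonneg hlam (prod_nonneg fun c _ => by linarith [hx c])
  unfold hcStep
  refine ⟨div_nonneg hP (by linarith), ?_⟩
  rw [div_lt_one (by linarith)]
  linarith

/-! #### The `L`-level aggregation map `g` and its properties -/

/-- **The depth-`L` aggregation map** `g = hcIter L`: feed real boundary values `x_u ∈ [0,1]`
(occupation probabilities of the `q^L` vertices `u` on level `L`) through `L` levels of the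
recursion `Φ` (Sly's `X_{ρ,ℓ,s} = g(𝒳_{L,ℓ,s})`). [cite: Sly2010, §4 (proof of Lemma 4.2, "`X_{ρ,ℓ,s} = g(𝒳_{L,ℓ,s})`")] -/
noncomputable def hcIter (q : ℕ) (lam : ℝ) : (L : ℕ) → (Fin (q ^ L) → ℝ) → ℝ
  | 0, x => x ⟨0, by simp⟩
  | L + 1, x => hcStep q lam fun c => hcIter q lam L (hcBlockConfig x c)

/-- Unfolding lemma for `hcIter` at depth `0`. [folklore] -/
theorem hcIter_zero (x : Fin (q ^ 0) → ℝ) : hcIter q lam 0 x = x ⟨0, by simp⟩ := rfl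

/-- Unfolding lemma for `hcIter` at depth `L+1`. [folklore] -/
theorem hcIter_succ (L : ℕ) (x : Fin (q ^ (L + 1)) → ℝ) :
    hcIter q lam (L + 1) x = hcStep q lam fun c => hcIter q lam L (hcBlockConfig x c) := rfl

/-- `X_L(A) = g(𝟙_A)`: the root marginal given the leaves is the aggregation of the `0/1` boundary
values. [folklore] -/
theorem hcTreeX_eq_hcIter (hlam : 0 ≤ lam) : ∀ (L : ℕ) (A : Fin (q ^ L) → Bool),
    hcTreeX q lam L A = hcIter q lam L fun u => if A u then 1 else 0
  | 0, A => by
    rw [hcIter_zero]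
    unfold hcTreeX hcTreeZtot
    rw [hcTreeZ_zero, hcTreeZ_zero]
    cases A ⟨0, by simp⟩ <;> simp
  | L + 1, A => by
    rw [hcTreeX_succ hlam, hcIter_succ]
    congr 1
    funext c
    exact hcTreeX_eq_hcIter hlam L _

/-- Inputs in `[0,1]` give outputs in `[0,1]`. [folklore] -/
theorem hcIter_mem_Icc (hlam : 0 ≤ lam) : ∀ (L : ℕ) (x : Fin (q ^ L) → ℝ)
    (_ : ∀ u, x u ∈ Set.Icc (0 : ℝ) 1), hcIter q lam L x ∈ Set.Icc (0 : ℝ) 1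
  | 0, x, hx => hx _
  | L + 1, x, hx => by
    rw [hcIter_succ]
    have h := hcStep_mem_Ico hlam (x := fun c => hcIter q lam L (hcBlockConfig x c))
      (fun c => (hcIter_mem_Icc hlam L _ fun u => hx _).2)
    exact ⟨h.1, h.2.le⟩

/-- The block structure is compatible with sub-blocks:
`(A|_{block c})|_{subtree u'} = A|_{subtree (c, u')}`. [folklore] -/
def hcSubConfig {q K L : ℕ} {β : Type*} (A : Fin (q ^ (K + L)) → β) (u : Fin (q ^ L)) : Fin (q ^ K) → β :=
  fun j => A ⟨u * q ^ K + j, by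
    have hj := j.isLt
    have hu := u.isLt
    calc (u : ℕ) * q ^ K + j < u * q ^ K + q ^ K := by omega
      _ = (u + 1) * q ^ K := by ring
      _ ≤ q ^ L * q ^ K := Nat.mul_le_mul_right _ hu
      _ = q ^ (K + L) := by rw [pow_add, mul_comm]⟩

/-- Sub-blocks of a block are sub-blocks: `(A|_{block c})|_{u'} = A|_{(c, u')}`. [folklore] -/
theorem hcSubConfig_hcBlockConfig {q K L : ℕ} {β : Type*} (A : Fin (q ^ (K + (L + 1))) → β) (c : Fin q)
    (u' : Fin (q ^ L)) :
    hcSubConfig (K := K) (L := L) (hcBlockConfig (L := K + L) A c) u' =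
      hcSubConfig (K := K) (L := L + 1) A (hcBlock q L c u') := by
  funext j
  unfold hcSubConfig hcBlockConfig hcBlock
  congr 1
  apply Fin.ext
  simp only
  rw [pow_add]
  ring

/-- **Composition of the recursion**: the root marginal of the depth-`K+L` tree is the depth-`L`
aggregation of the root marginals of the `q^L` depth-`K` subtrees hanging at level `L`
(Sly: "by recursively applying (e:treeRecursionNoTilde) we can write `X_{ρ,ℓ,s} = g(𝒳_{L,ℓ,s})`").
[cite: Sly2010, §4 (proof of Lemma 4.2)] -/
theorem hcTreeX_add (hlam : 0 ≤ lam) (K : ℕ) : ∀ (L : ℕ) (A : Fin (q ^ (K + L)) → Bool),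
    hcTreeX q lam (K + L) A = hcIter q lam L fun u => hcTreeX q lam K (hcSubConfig A u)
  | 0, A => by
    rw [hcIter_zero]
    congr 1
    funext j
    unfold hcSubConfig
    congr 1
    apply Fin.ext
    simp
  | L + 1, A => by
    show hcTreeX q lam (K + L + 1) A = _
    rw [hcTreeX_succ hlam, hcIter_succ]
    congr 1
    funext c
    rw [hcTreeX_add hlam K L]
    congr 1
    funext u'
    rw [hcSubConfig_hcBlockConfig]
    rfl

/-- Constant boundary values aggregate to the iterate of `φ(y) = Φ(y, …, y)`. [folklore] -/
theorem hcIter_const : ∀ (L : ℕ) (y : ℝ),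
    hcIter q lam L (fun _ => y) = (fun z => hcStep q lam fun _ : Fin q => z)^[L] y
  | 0, y => by rw [hcIter_zero, Function.iterate_zero, id]
  | L + 1, y => by
    rw [hcIter_succ, Function.iterate_succ_apply']
    congr 1
    funext c
    exact hcIter_const L y

/-! #### The sandwich between extreme boundary conditions -/

/-- The one-variable map `φ(y) = λ(1-y)^q/(1+λ(1-y)^q)` (all children equal). [folklore] -/
noncomputable def hcPhi (q : ℕ) (lam : ℝ) (y : ℝ) : ℝ := hcStep q lam fun _ : Fin q => y

/-- `φ(y) = λ(1-y)^q/(1+λ(1-y)^q)`. [cite: Sly2010, §1.3 (tree recursion for `q^{±}`)] -/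
theorem hcPhi_eq (y : ℝ) : hcPhi q lam y = lam * (1 - y) ^ q / (1 + lam * (1 - y) ^ q) := by
  unfold hcPhi hcStep
  rw [Finset.prod_const, Finset.card_univ, Fintype.card_fin]

/-- Constant boundary values aggregate to iterates of `φ`. [folklore] -/
theorem hcIter_const' (L : ℕ) (y : ℝ) : hcIter q lam L (fun _ => y) = (hcPhi q lam)^[L] y := by
  rw [hcIter_const]; rfl

/-- **Lower and upper envelopes** after `k` levels when the inputs lie in `[a, b]`:
`(lo, up)_0 = (a, b)`, `(lo, up)_{k+1} = (φ(up_k), φ(lo_k))` (the recursion is antitone).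
With `(a, b) = (0, 1)` these are the root marginals under the extreme boundary conditions
("this is the case for even conditioning `S_{v,ℓ}` to be all `0` or `1`"). [cite: Sly2010, §4 (proof of Lemma 4.2)] -/
noncomputable def hcEnv (q : ℕ) (lam a b : ℝ) : ℕ → ℝ × ℝ
  | 0 => (a, b)
  | k + 1 => (hcPhi q lam (hcEnv q lam a b k).2, hcPhi q lam (hcEnv q lam a b k).1)

/-- Unfolding lemma for the envelopes at `k = 0`. [folklore] -/
theorem hcEnv_zero (a b : ℝ) : hcEnv q lam a b 0 = (a, b) := rfl

/-- Unfolding lemma for the envelopes at `k + 1`. [folklore] -/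
theorem hcEnv_succ (a b : ℝ) (k : ℕ) :
    hcEnv q lam a b (k + 1) = (hcPhi q lam (hcEnv q lam a b k).2, hcPhi q lam (hcEnv q lam a b k).1) := rfl

/-- The envelopes stay in `[0,1]` and ordered. [folklore] -/
theorem hcEnv_mem (hlam : 0 ≤ lam) {a b : ℝ} (ha : 0 ≤ a) (hab : a ≤ b) (hb : b ≤ 1) :
    ∀ k, 0 ≤ (hcEnv q lam a b k).1 ∧ (hcEnv q lam a b k).1 ≤ (hcEnv q lam a b k).2 ∧ (hcEnv q lam a b k).2 ≤ 1
  | 0 => ⟨ha, hab, hb⟩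
  | k + 1 => by
    obtain ⟨h1, h2, h3⟩ := hcEnv_mem hlam ha hab hb k
    rw [hcEnv_succ]
    refine ⟨(hcStep_mem_Ico hlam fun _ => h3).1, ?_, (hcStep_mem_Ico hlam fun _ => h2.trans h3).2.le⟩
    exact hcStep_antitone hlam (fun _ => h2) fun _ => h3

/-- **The sandwich**: inputs in `[a, b] ⊆ [0, 1]` give `lo_L ≤ g(x) ≤ up_L`. In particular every
root marginal `X_L(A)` lies between the values for the all-`0` and all-`1` boundary conditions.
[cite: Sly2010, §4 (proof of Lemma 4.2)] -/
theorem hcIter_mem_env (hlam : 0 ≤ lam) {a b : ℝ} (ha : 0 ≤ a) (hab : a ≤ b) (hb : b ≤ 1) :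
    ∀ (L : ℕ) (x : Fin (q ^ L) → ℝ) (_ : ∀ u, x u ∈ Set.Icc a b),
      hcIter q lam L x ∈ Set.Icc (hcEnv q lam a b L).1 (hcEnv q lam a b L).2
  | 0, x, hx => hx _
  | L + 1, x, hx => by
    rw [hcIter_succ, hcEnv_succ]
    obtain ⟨h1, -, h3⟩ := hcEnv_mem hlam ha hab hb L (q := q)
    have hc : ∀ c, hcIter q lam L (hcBlockConfig x c) ∈ Set.Icc (hcEnv q lam a b L).1 (hcEnv q lam a b L).2 :=
      fun c => hcIter_mem_env hlam ha hab hb L _ fun u => hx _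
    exact ⟨hcStep_antitone hlam (fun c => (hc c).2) fun _ => h3,
      hcStep_antitone hlam (fun c => (hc c).1) fun c => (hc c).2.trans h3⟩

/-! #### The `L`-step contraction (Sly's `(3/4)^L` bound) -/

/-- Every leaf index of the depth-`L+1` tree lies in a unique child block. [folklore] -/
theorem exists_hcBlock_eq {q L : ℕ} (u : Fin (q ^ (L + 1))) : ∃ c u', hcBlock q L c u' = u := by
  rcases Nat.eq_zero_or_pos q with rfl | hq
  · exact absurd u.isLt (by simp)
  have hqL : 0 < q ^ L := pow_pos hq L
  have hu := u.isLt
  refine ⟨⟨u / q ^ L, (Nat.div_lt_iff_lt_mul hqL).2 (by rw [← pow_succ']; exact hu)⟩,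
    ⟨u % q ^ L, Nat.mod_lt _ hqL⟩, Fin.ext ?_⟩
  simp only [hcBlock]
  exact Nat.div_add_mod' u (q ^ L)

/-- Blocks do not overlap. [folklore] -/
theorem hcBlock_injective2 {q L : ℕ} {c c' : Fin q} {i i' : Fin (q ^ L)}
    (h : hcBlock q L c i = hcBlock q L c' i') : c = c' ∧ i = i' := by
  rcases Nat.eq_zero_or_pos q with rfl | hq
  · exact absurd c.isLt (by simp)
  have hqL : 0 < q ^ L := pow_pos hq L
  have hv : (c : ℕ) * q ^ L + i = c' * q ^ L + i' := by
    have := congrArg Fin.val h; simpa [hcBlock] using this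
  have hi := i.isLt
  have hi' := i'.isLt
  have hc : (c : ℕ) = c' := by
    have h1 : ((c : ℕ) * q ^ L + i) / q ^ L = c := by
      rw [add_comm, Nat.add_mul_div_right _ _ hqL, Nat.div_eq_of_lt hi, zero_add]
    have h2 : ((c' : ℕ) * q ^ L + i') / q ^ L = c' := by
      rw [add_comm, Nat.add_mul_div_right _ _ hqL, Nat.div_eq_of_lt hi', zero_add]
    rw [← h1, ← h2, hv]
  refine ⟨Fin.ext hc, Fin.ext ?_⟩
  rw [hc] at hv
  omega

/-- Summing over the leaves block by block. [folklore] -/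
theorem sum_hcBlock {q L : ℕ} {M : Type*} [AddCommMonoid M] (f : Fin (q ^ (L + 1)) → M) :
    ∑ c : Fin q, ∑ i : Fin (q ^ L), f (hcBlock q L c i) = ∑ u, f u := by
  rw [← Fintype.sum_prod_type']
  refine Fintype.sum_bijective (fun p : Fin q × Fin (q ^ L) => hcBlock q L p.1 p.2) ?_ _ _ fun _ => rfl
  refine (Fintype.bijective_iff_injective_and_card _).2 ⟨fun p p' h => ?_, by simp [pow_succ']⟩
  obtain ⟨h1, h2⟩ := hcBlock_injective2 h
  exact Prod.ext h1 h2

/-- **Goodness of a boundary field for the contraction**: all inputs lie in `[0,1]` and every value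
fed into an application of `Φ` inside the aggregation `g` is `≤ b` (Sly takes `b = q⁺ + 1/15 ≤ 2/3`,
guaranteed `ℓ - L > ℓ'` levels above the leaves). [cite: Sly2010, §4 (proof of Lemma 4.2)] -/
def hcGood (q : ℕ) (lam b : ℝ) : (L : ℕ) → (Fin (q ^ L) → ℝ) → Prop
  | 0, x => 0 ≤ x ⟨0, by simp⟩ ∧ x ⟨0, by simp⟩ ≤ 1
  | L + 1, x => ∀ c, hcGood q lam b L (hcBlockConfig x c) ∧ hcIter q lam L (hcBlockConfig x c) ≤ b

/-- Unfolding lemma for `hcGood` at depth `0`. [folklore] -/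
theorem hcGood_zero_iff (b : ℝ) (x : Fin (q ^ 0) → ℝ) :
    hcGood q lam b 0 x ↔ 0 ≤ x ⟨0, by simp⟩ ∧ x ⟨0, by simp⟩ ≤ 1 := Iff.rfl

/-- Unfolding lemma for `hcGood` at depth `L+1`. [folklore] -/
theorem hcGood_succ_iff (b : ℝ) (L : ℕ) (x : Fin (q ^ (L + 1)) → ℝ) :
    hcGood q lam b (L + 1) x ↔
      ∀ c, hcGood q lam b L (hcBlockConfig x c) ∧ hcIter q lam L (hcBlockConfig x c) ≤ b := Iff.rfl

/-- Good boundary fields take values in `[0,1]`. [folklore] -/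
theorem hcGood.inputs {b : ℝ} : ∀ {L : ℕ} {x : Fin (q ^ L) → ℝ}, hcGood q lam b L x → ∀ u, x u ∈ Set.Icc (0 : ℝ) 1
  | 0, x, h, u => by
    have hu : u = ⟨0, by simp⟩ := Fin.ext (by
      have h1 : (u : ℕ) < q ^ 0 := u.isLt
      have h2 : q ^ 0 = 1 := pow_zero q
      simp only
      omega)
    subst hu; exact h
  | L + 1, x, h, u => by
    obtain ⟨c, u', rfl⟩ := exists_hcBlock_eq u
    exact hcGood.inputs (h c).1 u'

/-- **The `L`-step contraction** (Sly: "recursively applying this relation,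
`|g(𝒳_{L,ℓ,s}) - g(𝒳'_{L,ℓ,s})| ≤ (3/4)^L |X_{u,ℓ-L,s} - X'_{u,ℓ-L,s}|`", here summed over all the
level-`L` inputs that differ): for good boundary fields (`b = 2/3`),
`|g(x) - g(x')| ≤ (3/4)^L Σ_u |x_u - x'_u|`. [cite: Sly2010, §4 (proof of Lemma 4.2, eq. (e:onePointCorrelations))] -/
theorem hcIter_contract (hlam : 0 ≤ lam) : ∀ (L : ℕ) (x x' : Fin (q ^ L) → ℝ)
    (_ : hcGood q lam (2 / 3) L x) (_ : hcGood q lam (2 / 3) L x'),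
    |hcIter q lam L x - hcIter q lam L x'| ≤ (3 / 4) ^ L * ∑ u, |x u - x' u|
  | 0, x, x', _, _ => by
    rw [hcIter_zero, hcIter_zero, show ((3 : ℝ) / 4) ^ 0 = 1 from pow_zero _, one_mul]
    exact Finset.single_le_sum (f := fun u => |x u - x' u|) (fun u _ => abs_nonneg _)
      (Finset.mem_univ (⟨0, by simp⟩ : Fin (q ^ 0)))
  | L + 1, x, x', hx, hx' => by
    rw [hcIter_succ, hcIter_succ]
    have hy : ∀ c, hcIter q lam L (hcBlockConfig x c) ∈ Set.Icc (0 : ℝ) 1 :=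
      fun c => hcIter_mem_Icc hlam L _ (hcGood.inputs (hx c).1)
    have hy' : ∀ c, hcIter q lam L (hcBlockConfig x' c) ∈ Set.Icc (0 : ℝ) 1 :=
      fun c => hcIter_mem_Icc hlam L _ (hcGood.inputs (hx' c).1)
    refine (hcStep_lipschitz hlam _ _ (fun c => (hy c).1) (fun c => (hx c).2) (fun c => (hy' c).1)
      (fun c => (hx' c).2)).trans ?_
    have hIH : ∀ c, |hcIter q lam L (hcBlockConfig x c) - hcIter q lam L (hcBlockConfig x' c)| ≤
        (3 / 4) ^ L * ∑ u', |hcBlockConfig x c u' - hcBlockConfig x' c u'| :=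
      fun c => hcIter_contract hlam L _ _ (hx c).1 (hx' c).1
    calc 3 / 4 * ∑ c, |hcIter q lam L (hcBlockConfig x c) - hcIter q lam L (hcBlockConfig x' c)|
        ≤ 3 / 4 * ∑ c, (3 / 4) ^ L * ∑ u', |hcBlockConfig x c u' - hcBlockConfig x' c u'| :=
          mul_le_mul_of_nonneg_left (sum_le_sum fun c _ => hIH c) (by norm_num)
      _ = (3 / 4) ^ (L + 1) * ∑ c, ∑ u', |x (hcBlock q L c u') - x' (hcBlock q L c u')| := by
          rw [← Finset.mul_sum, pow_succ]; unfold hcBlockConfig; ring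
      _ = (3 / 4) ^ (L + 1) * ∑ u, |x u - x' u| := by rw [sum_hcBlock (fun u => |x u - x' u|)]

/-- The aggregation of a block of subtree marginals is the marginal of the corresponding subtree. [folklore] -/
theorem hcIter_block_subtree (hlam : 0 ≤ lam) (K L : ℕ) (A : Fin (q ^ (K + (L + 1))) → Bool) (c : Fin q) :
    hcIter q lam L (hcBlockConfig (fun u => hcTreeX q lam K (hcSubConfig (K := K) (L := L + 1) A u)) c) =
      hcTreeX q lam (K + L) (hcBlockConfig (L := K + L) A c) := by
  rw [hcTreeX_add hlam K L]
  congr 1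
  funext u'
  unfold hcBlockConfig
  simp only
  rw [← hcSubConfig_hcBlockConfig]
  rfl

/-- **The depth condition makes the subtree marginals good**: if the upper envelope `M_j` (all-`0/1`
extreme boundary) is `≤ b` at all heights `K ≤ j < K + L`, then the field `(X_K(A|_u))_u` of depth-`K`
subtree marginals is good for the `L`-level aggregation (Sly: "for `ℓ - L > ℓ'(d,λ,1/15)` …
`1 - X ≥ 1/3`"). [cite: Sly2010, §4 (proof of Lemma 4.2)] -/
theorem hcGood_subtree (hlam : 0 ≤ lam) (b : ℝ) (K : ℕ) : ∀ (L : ℕ) (A : Fin (q ^ (K + L)) → Bool)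
    (_ : ∀ j, j < L → (hcEnv q lam 0 1 (K + j)).2 ≤ b),
    hcGood q lam b L fun u => hcTreeX q lam K (hcSubConfig A u)
  | 0, A, _ => by
    rw [hcGood_zero_iff]
    exact hcTreeX_mem_Icc hlam K _
  | L + 1, A, hM => by
    rw [hcGood_succ_iff]
    intro c
    constructor
    · have h := hcGood_subtree hlam b K L (hcBlockConfig (L := K + L) A c) fun j hj => hM j (by omega)
      convert h using 2 with u'
      unfold hcBlockConfig
      simp only
      rw [← hcSubConfig_hcBlockConfig]
      rfl
    · rw [hcIter_block_subtree hlam]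
      refine le_trans ?_ (hM L (by omega))
      have h := hcIter_mem_env hlam le_rfl zero_le_one le_rfl (K + L)
        (fun u => if hcBlockConfig (L := K + L) A c u then (1 : ℝ) else 0) fun u => by
          split_ifs <;> exact ⟨by norm_num, by norm_num⟩
      rw [← hcTreeX_eq_hcIter hlam] at h
      exact h.2

/-- **Sly's one-point correlation bound on the tree** (eq. (e:onePointCorrelations)): if the extreme
boundary marginals `M_j` are `≤ 2/3` at all heights `K ≤ j < K + L`, then for any two leaf
configurations `A, A'` of the depth-`K+L` tree,
`|X_{K+L}(A) - X_{K+L}(A')| ≤ (3/4)^L Σ_{u on level L} |X_K(A|_u) - X_K(A'|_u)|`.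
[cite: Sly2010, §4 (proof of Lemma 4.2, eq. (e:onePointCorrelations))] -/
theorem hcTreeX_contract (hlam : 0 ≤ lam) (K L : ℕ) (A A' : Fin (q ^ (K + L)) → Bool)
    (hM : ∀ j, j < L → (hcEnv q lam 0 1 (K + j)).2 ≤ 2 / 3) :
    |hcTreeX q lam (K + L) A - hcTreeX q lam (K + L) A'| ≤
      (3 / 4) ^ L * ∑ u : Fin (q ^ L), |hcTreeX q lam K (hcSubConfig A u) - hcTreeX q lam K (hcSubConfig A' u)| := by
  rw [hcTreeX_add hlam K L, hcTreeX_add hlam K L]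
  exact hcIter_contract hlam L _ _ (hcGood_subtree hlam _ K L A hM) (hcGood_subtree hlam _ K L A' hM)

/-! #### Convergence of the envelopes to the two-cycle `(q⁻, q⁺)` -/

section Envelope

open Filter Topology

/-- `φ` is antitone on `(-∞, 1]` (`λ ≥ 0`). [folklore] -/
theorem hcPhi_antitone (hlam : 0 ≤ lam) {y y' : ℝ} (hyy' : y ≤ y') (hy' : y' ≤ 1) :
    hcPhi q lam y' ≤ hcPhi q lam y :=
  hcStep_antitone hlam (fun _ => hyy') fun _ => hy'

/-- `0 ≤ φ(y) < 1` for `y ≤ 1`. [folklore] -/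
theorem hcPhi_mem_Ico (hlam : 0 ≤ lam) {y : ℝ} (hy : y ≤ 1) : hcPhi q lam y ∈ Set.Ico (0 : ℝ) 1 :=
  hcStep_mem_Ico hlam fun _ => hy

/-- `φ` is continuous at every `y ≤ 1` (`λ ≥ 0`). [folklore] -/
theorem hcPhi_continuousAt (hlam : 0 ≤ lam) {y : ℝ} (hy : y ≤ 1) : ContinuousAt (hcPhi q lam) y := by
  have e : hcPhi q lam = fun y => lam * (1 - y) ^ q / (1 + lam * (1 - y) ^ q) := funext hcPhi_eq
  rw [e]
  have hden : (1 + lam * (1 - y) ^ q) ≠ 0 := by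
    have : 0 ≤ lam * (1 - y) ^ q := mul_nonneg hlam (pow_nonneg (by linarith) _)
    linarith
  exact ((continuous_const.mul ((continuous_const.sub continuous_id).pow q)).continuousAt).div
    ((continuous_const.add (continuous_const.mul ((continuous_const.sub continuous_id).pow q))).continuousAt)
    hden

variable (q lam) in
/-- The upper envelope `M_k`: the root marginal under the extreme boundary conditions (all leaves
occupied / unoccupied according to parity), `m_k ≤ X_k(A) ≤ M_k`. [cite: Sly2010, §4 (proof of Lemma 4.2)] -/
noncomputable def hcM (k : ℕ) : ℝ := (hcEnv q lam 0 1 k).2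

variable (q lam) in
/-- The lower envelope `m_k` (extreme boundary condition). [cite: Sly2010, §4 (proof of Lemma 4.2)] -/
noncomputable def hcm (k : ℕ) : ℝ := (hcEnv q lam 0 1 k).1

/-- `M_0 = 1`. [folklore] -/
theorem hcM_zero : hcM q lam 0 = 1 := rfl
/-- `m_0 = 0`. [folklore] -/
theorem hcm_zero : hcm q lam 0 = 0 := rfl
/-- `M_{k+1} = φ(m_k)`. [folklore] -/
theorem hcM_succ (k : ℕ) : hcM q lam (k + 1) = hcPhi q lam (hcm q lam k) := rfl
/-- `m_{k+1} = φ(M_k)`. [folklore] -/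
theorem hcm_succ (k : ℕ) : hcm q lam (k + 1) = hcPhi q lam (hcM q lam k) := rfl

/-- `0 ≤ m_k ≤ M_k ≤ 1`. [folklore] -/
theorem hcm_le_hcM_mem (hlam : 0 ≤ lam) (k : ℕ) : 0 ≤ hcm q lam k ∧ hcm q lam k ≤ hcM q lam k ∧ hcM q lam k ≤ 1 :=
  hcEnv_mem hlam le_rfl zero_le_one le_rfl k

/-- The envelopes enclose the two-cycle: `m_k ≤ q⁻ < q⁺ ≤ M_k`. [folklore] -/
theorem hcEnv_encloses (hlam : 0 ≤ lam) {qp qm : ℝ} (hqm : 0 ≤ qm) (hqp1 : qp ≤ 1)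
    (hp : qp = hcPhi q lam qm) (hm : qm = hcPhi q lam qp) :
    ∀ k, hcm q lam k ≤ qm ∧ qp ≤ hcM q lam k
  | 0 => ⟨hqm, hqp1⟩
  | k + 1 => by
    obtain ⟨h1, h2⟩ := hcEnv_encloses hlam hqm hqp1 hp hm k
    obtain ⟨-, -, hM1⟩ := hcm_le_hcM_mem hlam k (q := q)
    rw [hcm_succ, hcM_succ]
    exact ⟨hm ▸ hcPhi_antitone hlam h2 hM1, hp ▸ hcPhi_antitone hlam h1 (hm ▸ (hcPhi_mem_Ico hlam hqp1).2.le)⟩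

/-- The upper envelope decreases and the lower one increases along each parity. [folklore] -/
theorem hcEnv_monotone (hlam : 0 ≤ lam) : ∀ k, hcM q lam (k + 2) ≤ hcM q lam k ∧ hcm q lam k ≤ hcm q lam (k + 2)
  | 0 => by
    rw [hcM_zero, hcm_zero]
    exact ⟨(hcm_le_hcM_mem hlam 2).2.2, (hcm_le_hcM_mem hlam 2).1⟩
  | k + 1 => by
    obtain ⟨h1, h2⟩ := hcEnv_monotone hlam k
    rw [show k + 1 + 2 = k + 2 + 1 from rfl, hcM_succ, hcM_succ, hcm_succ, hcm_succ]
    exact ⟨hcPhi_antitone hlam h2 ((hcm_le_hcM_mem hlam (k + 2)).2.1.trans (hcm_le_hcM_mem hlam (k + 2)).2.2),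
      hcPhi_antitone hlam h1 (hcm_le_hcM_mem hlam k).2.2⟩

/-- A period-`2` point `y ≥ q⁺` of `φ` is `q⁺` (two-cycle uniqueness, Kelly). [folklore] -/
theorem eq_qp_of_period_two {d : ℕ} (hd : 3 ≤ d) (hlam : 0 < lam) {qp qm y : ℝ}
    (hlt : qm < qp) (hqp1 : qp < 1) (hp : qp = hcPhi (d - 1) lam qm) (hm : qm = hcPhi (d - 1) lam qp)
    (hy1 : y ≤ 1) (hyq : qp ≤ y) (hfix : hcPhi (d - 1) lam (hcPhi (d - 1) lam y) = y) : y = qp := by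
  set y' := hcPhi (d - 1) lam y with hy'
  have hy'1 : y' < 1 := (hcPhi_mem_Ico hlam.le hy1).2
  have hp' : qp = lam * (1 - qm) ^ (d - 1) / (1 + lam * (1 - qm) ^ (d - 1)) := by rw [← hcPhi_eq]; exact hp
  have hm' : qm = lam * (1 - qp) ^ (d - 1) / (1 + lam * (1 - qp) ^ (d - 1)) := by rw [← hcPhi_eq]; exact hm
  have hyy' : y' = lam * (1 - y) ^ (d - 1) / (1 + lam * (1 - y) ^ (d - 1)) := by rw [← hcPhi_eq]
  have hy'y : y = lam * (1 - y') ^ (d - 1) / (1 + lam * (1 - y') ^ (d - 1)) := by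
    rw [← hcPhi_eq]; exact hfix.symm
  rcases lt_trichotomy y' y with h | h | h
  · -- `(y, y')` is a two-cycle
    have hy1' : y < 1 := by rw [← hfix]; exact (hcPhi_mem_Ico hlam.le hy'1.le).2
    exact (hardCore_treeTwoCycle_unique hd hlam h hy1' hy'y hyy' hlt hqp1 hp' hm').1
  · -- a fixed point above `q⁺` is impossible
    exfalso
    have h1 : hcPhi (d - 1) lam y ≤ hcPhi (d - 1) lam qp := hcPhi_antitone hlam.le hyq hy1
    rw [← hm] at h1
    have h1' : y' ≤ qm := h1
    linarith
  · -- `(y', y)` would be a two-cycle with `y = q⁻ < q⁺ ≤ y`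
    exfalso
    have := (hardCore_treeTwoCycle_unique hd hlam h hy'1 hyy' hy'y hlt hqp1 hp' hm').2
    linarith

/-- A period-`2` point `y ≤ q⁻` of `φ` is `q⁻`. [folklore] -/
theorem eq_qm_of_period_two {d : ℕ} (hd : 3 ≤ d) (hlam : 0 < lam) {qp qm y : ℝ}
    (hlt : qm < qp) (hqp1 : qp < 1) (hp : qp = hcPhi (d - 1) lam qm) (hm : qm = hcPhi (d - 1) lam qp)
    (hy1 : y ≤ 1) (hyq : y ≤ qm) (hfix : hcPhi (d - 1) lam (hcPhi (d - 1) lam y) = y) : y = qm := by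
  set y' := hcPhi (d - 1) lam y with hy'
  have hy'1 : y' < 1 := (hcPhi_mem_Ico hlam.le hy1).2
  have hqm1 : qm ≤ 1 := by linarith
  have hp' : qp = lam * (1 - qm) ^ (d - 1) / (1 + lam * (1 - qm) ^ (d - 1)) := by rw [← hcPhi_eq]; exact hp
  have hm' : qm = lam * (1 - qp) ^ (d - 1) / (1 + lam * (1 - qp) ^ (d - 1)) := by rw [← hcPhi_eq]; exact hm
  have hyy' : y' = lam * (1 - y) ^ (d - 1) / (1 + lam * (1 - y) ^ (d - 1)) := by rw [← hcPhi_eq]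
  have hy'y : y = lam * (1 - y') ^ (d - 1) / (1 + lam * (1 - y') ^ (d - 1)) := by
    rw [← hcPhi_eq]; exact hfix.symm
  rcases lt_trichotomy y y' with h | h | h
  · exact (hardCore_treeTwoCycle_unique hd hlam h hy'1 hyy' hy'y hlt hqp1 hp' hm').2
  · exfalso
    have h1 : hcPhi (d - 1) lam qm ≤ hcPhi (d - 1) lam y := hcPhi_antitone hlam.le hyq hqm1
    rw [← hp] at h1
    have h1' : qp ≤ y' := h1
    linarith
  · exfalso
    have hy1' : y < 1 := by rw [← hfix]; exact (hcPhi_mem_Ico hlam.le hy'1.le).2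
    have := (hardCore_treeTwoCycle_unique hd hlam h hy1' hy'y hyy' hlt hqp1 hp' hm').1
    linarith

/-- **The extreme-boundary marginals converge to the two-cycle**: `M_k → q⁺` and `m_k → q⁻`, so for
every `δ > 0` all root marginals `X_{v,k}(A)`, `k ≥ ℓ'(d, λ, δ)`, lie in `(q⁻ - δ, q⁺ + δ)` whatever the
boundary condition (Sly: "for any `δ > 0` there exists `ℓ'(d,λ,δ)` such that for `ℓ > ℓ'` we have
`X_{v,ℓ,s} < q⁺ + δ` since this is the case for even conditioning `S_{v,ℓ}` to be all `0` or `1`").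
[cite: Sly2010, §4 (proof of Lemma 4.2)] -/
theorem hcEnv_eventually {d : ℕ} (hd : 3 ≤ d) {lam : ℝ} (hlam : 0 < lam) {qp qm : ℝ} (hqm : 0 < qm)
    (hlt : qm < qp) (hqp1 : qp < 1) (hp : qp = hcPhi (d - 1) lam qm) (hm : qm = hcPhi (d - 1) lam qp)
    {δ : ℝ} (hδ : 0 < δ) :
    ∃ k₀ : ℕ, ∀ k, k₀ ≤ k → hcM (d - 1) lam k ≤ qp + δ ∧ qm - δ ≤ hcm (d - 1) lam k := by
  set φ := hcPhi (d - 1) lam with hφ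
  have henc := hcEnv_encloses (q := d - 1) hlam.le hqm.le hqp1.le hp hm
  have hmono := hcEnv_monotone (q := d - 1) hlam.le
  have hmem := hcm_le_hcM_mem (q := d - 1) hlam.le
  -- even upper envelope `A j = M_{2j}` ↓ ℓ ≥ q⁺
  set A : ℕ → ℝ := fun j => hcM (d - 1) lam (2 * j) with hA
  have hAanti : Antitone A := antitone_nat_of_succ_le fun j => by
    simp only [hA, show 2 * (j + 1) = 2 * j + 2 by ring]; exact (hmono _).1
  have hAbdd : BddBelow (Set.range A) := ⟨qp, by rintro _ ⟨j, rfl⟩; exact (henc _).2⟩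
  have hAlim := tendsto_atTop_ciInf hAanti hAbdd
  set ℓ := ⨅ j, A j with hℓ
  have hℓqp : qp ≤ ℓ := le_ciInf fun j => (henc _).2
  have hℓ1 : ℓ ≤ 1 := (ciInf_le hAbdd 0).trans (hmem 0).2.2
  have hAstep : ∀ j, A (j + 1) = φ (φ (A j)) := fun j => by
    simp only [hA, show 2 * (j + 1) = 2 * j + 1 + 1 by ring, hcM_succ, hcm_succ]
    rfl
  have hℓfix : φ (φ ℓ) = ℓ := by
    have h1 : Tendsto (fun j => A (j + 1)) atTop (𝓝 ℓ) := hAlim.comp (tendsto_add_atTop_nat 1)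
    have hc1 : ContinuousAt φ ℓ := hcPhi_continuousAt hlam.le hℓ1
    have hc2 : ContinuousAt φ (φ ℓ) := hcPhi_continuousAt hlam.le (hcPhi_mem_Ico hlam.le hℓ1).2.le
    have h2 : Tendsto (fun j => φ (φ (A j))) atTop (𝓝 (φ (φ ℓ))) := (hc2.comp hc1).tendsto.comp hAlim
    simp_rw [← hAstep] at h2
    exact tendsto_nhds_unique h2 h1
  have hℓeq : ℓ = qp := eq_qp_of_period_two hd hlam hlt hqp1 hp hm hℓ1 hℓqp hℓfix
  -- even lower envelope `B j = m_{2j}` ↑ ℓ₂ ≤ q⁻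
  set B : ℕ → ℝ := fun j => hcm (d - 1) lam (2 * j) with hB
  have hBmono : Monotone B := monotone_nat_of_le_succ fun j => by
    simp only [hB, show 2 * (j + 1) = 2 * j + 2 by ring]; exact (hmono _).2
  have hBbdd : BddAbove (Set.range B) := ⟨qm, by rintro _ ⟨j, rfl⟩; exact (henc _).1⟩
  have hBlim := tendsto_atTop_ciSup hBmono hBbdd
  set ℓ₂ := ⨆ j, B j with hℓ₂
  have hℓ₂qm : ℓ₂ ≤ qm := ciSup_le fun j => (henc _).1
  have hℓ₂1 : ℓ₂ ≤ 1 := by linarith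
  have hBstep : ∀ j, B (j + 1) = φ (φ (B j)) := fun j => by
    simp only [hB, show 2 * (j + 1) = 2 * j + 1 + 1 by ring, hcM_succ, hcm_succ]
    rfl
  have hℓ₂fix : φ (φ ℓ₂) = ℓ₂ := by
    have h1 : Tendsto (fun j => B (j + 1)) atTop (𝓝 ℓ₂) := hBlim.comp (tendsto_add_atTop_nat 1)
    have hc1 : ContinuousAt φ ℓ₂ := hcPhi_continuousAt hlam.le hℓ₂1
    have hc2 : ContinuousAt φ (φ ℓ₂) := hcPhi_continuousAt hlam.le (hcPhi_mem_Ico hlam.le hℓ₂1).2.le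
    have h2 : Tendsto (fun j => φ (φ (B j))) atTop (𝓝 (φ (φ ℓ₂))) := (hc2.comp hc1).tendsto.comp hBlim
    simp_rw [← hBstep] at h2
    exact tendsto_nhds_unique h2 h1
  have hℓ₂eq : ℓ₂ = qm := eq_qm_of_period_two hd hlam hlt hqp1 hp hm hℓ₂1 hℓ₂qm hℓ₂fix
  -- odd subsequences by continuity: `M_{2j+1} = φ(m_{2j}) → φ(q⁻) = q⁺`, `m_{2j+1} = φ(M_{2j}) → q⁻`
  have hA' : Tendsto (fun j => hcM (d - 1) lam (2 * j + 1)) atTop (𝓝 qp) := by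
    have hc : ContinuousAt φ qm := hcPhi_continuousAt hlam.le (by linarith)
    have := hc.tendsto.comp (hℓ₂eq ▸ hBlim)
    rw [← hp] at this
    exact this
  have hB' : Tendsto (fun j => hcm (d - 1) lam (2 * j + 1)) atTop (𝓝 qm) := by
    have hc : ContinuousAt φ qp := hcPhi_continuousAt hlam.le hqp1.le
    have := hc.tendsto.comp (hℓeq ▸ hAlim)
    rw [← hm] at this
    exact this
  rw [hℓeq] at hAlim
  rw [hℓ₂eq] at hBlim
  -- extract thresholds
  have e1 := (Metric.tendsto_atTop.1 hAlim) δ hδ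
  have e2 := (Metric.tendsto_atTop.1 hA') δ hδ
  have e3 := (Metric.tendsto_atTop.1 hBlim) δ hδ
  have e4 := (Metric.tendsto_atTop.1 hB') δ hδ
  obtain ⟨J1, hJ1⟩ := e1
  obtain ⟨J2, hJ2⟩ := e2
  obtain ⟨J3, hJ3⟩ := e3
  obtain ⟨J4, hJ4⟩ := e4
  refine ⟨2 * (J1 + J2 + J3 + J4) + 1, fun k hk => ?_⟩
  obtain ⟨j, rfl | rfl⟩ := Nat.even_or_odd' k
  · have hj : J1 + J2 + J3 + J4 ≤ j := by omega
    have h1 := hJ1 j (by omega)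
    have h3 := hJ3 j (by omega)
    rw [Real.dist_eq, abs_lt] at h1 h3
    exact ⟨by simp only [hA] at h1; linarith [h1.2], by simp only [hB] at h3; linarith [h3.1]⟩
  · have h2 := hJ2 j (by omega)
    have h4 := hJ4 j (by omega)
    rw [Real.dist_eq, abs_lt] at h2 h4
    exact ⟨by linarith [h2.2], by linarith [h4.1]⟩

end Envelope

/-! #### Strict attraction of the two-cycle: `(d-1)² q⁺ q⁻ < 1` (brick C') -/

section Attraction

/-- **Strict AM–GM for a geometric sum**: `(m+1)² r^m < (1 + r + ⋯ + r^m)²` for `r > 1`, `m ≥ 1`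
(pair `r^i` with `r^{m-i}`: `r^i + r^{m-i} ≥ 2√(r^m)`, strictly for the pair `i = 0`). [folklore] -/
theorem sq_mul_pow_lt_geom_sum_sq {r : ℝ} (hr : 1 < r) {m : ℕ} (hm : 1 ≤ m) :
    ((m : ℝ) + 1) ^ 2 * r ^ m < (∑ i ∈ range (m + 1), r ^ i) ^ 2 := by
  have hr0 : 0 ≤ r := by linarith
  set ρ : ℝ := Real.sqrt (r ^ m) with hρ
  have hρ0 : 0 ≤ ρ := Real.sqrt_nonneg _
  have hρ2 : ρ ^ 2 = r ^ m := Real.sq_sqrt (pow_nonneg hr0 m)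
  -- pairwise AM–GM
  have hpair : ∀ i ∈ range (m + 1), 2 * ρ ≤ r ^ i + r ^ (m - i) := by
    intro i hi
    rw [Finset.mem_range] at hi
    have h1 : Real.sqrt (r ^ i) * Real.sqrt (r ^ (m - i)) = ρ := by
      rw [← Real.sqrt_mul (pow_nonneg hr0 i), ← pow_add, show i + (m - i) = m by omega]
    have h2 := Real.sq_sqrt (pow_nonneg hr0 i)
    have h3 := Real.sq_sqrt (pow_nonneg hr0 (m - i))
    nlinarith [sq_nonneg (Real.sqrt (r ^ i) - Real.sqrt (r ^ (m - i)))]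
  -- the pair `i = 0` is strict
  have hstrict : 2 * ρ < r ^ 0 + r ^ (m - 0) := by
    rw [pow_zero, Nat.sub_zero]
    have hρ1 : 1 < ρ := by
      rw [hρ, show (1 : ℝ) = Real.sqrt 1 from Real.sqrt_one.symm]
      exact Real.sqrt_lt_sqrt zero_le_one (one_lt_pow₀ hr (by omega))
    nlinarith [sq_nonneg (ρ - 1)]
  have hsum : 2 * ∑ i ∈ range (m + 1), r ^ i = ∑ i ∈ range (m + 1), (r ^ i + r ^ (m - i)) := by
    rw [Finset.sum_add_distrib, two_mul]
    congr 1
    rw [← Finset.sum_range_reflect (fun i => r ^ (m - i)) (m + 1)]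
    refine Finset.sum_congr rfl fun i hi => ?_
    rw [Finset.mem_range] at hi
    congr 1
    omega
  have hlt : ∑ i ∈ range (m + 1), 2 * ρ < ∑ i ∈ range (m + 1), (r ^ i + r ^ (m - i)) :=
    Finset.sum_lt_sum hpair ⟨0, by simp, hstrict⟩
  rw [Finset.sum_const, Finset.card_range, nsmul_eq_mul, ← hsum] at hlt
  push_cast at hlt
  -- `(m+1) ρ < S`, square it
  have hS : ((m : ℝ) + 1) * ρ < ∑ i ∈ range (m + 1), r ^ i := by linarith
  have hS0 : 0 ≤ ((m : ℝ) + 1) * ρ := by positivity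
  calc ((m : ℝ) + 1) ^ 2 * r ^ m = (((m : ℝ) + 1) * ρ) ^ 2 := by rw [mul_pow, hρ2]
    _ < (∑ i ∈ range (m + 1), r ^ i) ^ 2 := pow_lt_pow_left₀ hS hS0 two_ne_zero

/-- **The two-cycle is strictly attracting**: for `d ≥ 3`, `λ > 0` and the two-cycle
`0 < q⁻ < q⁺ < 1` of `φ`, the multiplier of `φ ∘ φ` at `q⁺` is `φ'(q⁻) φ'(q⁺) = (d-1)² q⁺ q⁻ < 1`.
In Kelly's parametrisation `r = (1-q⁻)/(1-q⁺) > 1` (`hardCore_treeTwoCycle_param`):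
`q⁻ = 1/(1 + r + ⋯ + r^{d-2})`, `q⁺ = r^{d-2} q⁻`, so `(d-1)² q⁺q⁻ = (d-1)² r^{d-2}/(Σ_{i<d-1} r^i)² < 1`
by the strict AM–GM inequality. Consequently Sly's (e:extraConditions) `(d-1) q⁺ q⁻ < 1` holds for
ALL `λ > λ_c` (as `q⁺q⁻ < 1`). [cite: Sly2010, §1.3 (eq. (e:extraConditions): "the first can be shown to hold for all `λ > λ_c`")] -/
theorem twoCycle_multiplier_lt_one {d : ℕ} (hd : 3 ≤ d) {lam qp qm : ℝ} (hlam : 0 < lam)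
    (hlt : qm < qp) (hqp : qp < 1) (hp : qp = hcPhi (d - 1) lam qm) (hm : qm = hcPhi (d - 1) lam qp) :
    ((d : ℝ) - 1) ^ 2 * (qp * qm) < 1 := by
  obtain ⟨m, rfl⟩ : ∃ m, d = m + 3 := ⟨d - 3, by omega⟩
  have hk : m + 3 - 1 = m + 2 := rfl
  rw [hk] at hp hm
  rw [hcPhi_eq] at hp hm
  obtain ⟨hr1, haS, -⟩ := hardCore_treeTwoCycle_param hlam hlt hqp hp hm
  set r : ℝ := (1 - qm) / (1 - qp) with hr
  set S : ℝ := ∑ i ∈ range (m + 1), r ^ i with hS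
  have hr0 : 0 < r := by linarith
  have hS0 : 0 < S := Finset.sum_pos (fun i _ => pow_pos hr0 i) ⟨0, by simp⟩
  have hqm1 : qm < 1 := by linarith
  -- `qm = 1/(1 + r S)` and `S' := 1 + r S = Σ_{i ≤ m+1} r^i`
  have hqm : qm = 1 / (1 + r * S) := by
    have h1 : 1 - qm ≠ 0 := by linarith
    field_simp at haS
    field_simp
    linarith
  -- `qp = r^{m+1} qm`: from the two cycle equations `qp/(1-qp) = λ(1-qm)^k`, `qm/(1-qm) = λ(1-qp)^k`
  have hqp0 : 0 < 1 - qp := by linarith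
  have hqm0 : 0 < 1 - qm := by linarith
  have e1 : qp = lam * (1 - qm) ^ (m + 2) * (1 - qp) := by
    have hden : (1 + lam * (1 - qm) ^ (m + 2)) ≠ 0 := by positivity
    rw [hp]; field_simp; ring
  have e2 : qm = lam * (1 - qp) ^ (m + 2) * (1 - qm) := by
    have hden : (1 + lam * (1 - qp) ^ (m + 2)) ≠ 0 := by positivity
    rw [hm]; field_simp; ring
  have e3 : qp * (1 - qp) ^ (m + 1) = qm * (1 - qm) ^ (m + 1) := by
    have h1 : qp * (1 - qp) ^ (m + 1) = lam * (1 - qm) ^ (m + 2) * (1 - qp) ^ (m + 2) :=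
      calc qp * (1 - qp) ^ (m + 1) = (lam * (1 - qm) ^ (m + 2) * (1 - qp)) * (1 - qp) ^ (m + 1) := by rw [← e1]
        _ = lam * (1 - qm) ^ (m + 2) * (1 - qp) ^ (m + 2) := by ring
    have h2 : qm * (1 - qm) ^ (m + 1) = lam * (1 - qp) ^ (m + 2) * (1 - qm) ^ (m + 2) :=
      calc qm * (1 - qm) ^ (m + 1) = (lam * (1 - qp) ^ (m + 2) * (1 - qm)) * (1 - qm) ^ (m + 1) := by rw [← e2]
        _ = lam * (1 - qp) ^ (m + 2) * (1 - qm) ^ (m + 2) := by ring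
    rw [h1, h2]; ring
  have hratio : qp = r ^ (m + 1) * qm := by
    rw [hr, div_pow, div_mul_eq_mul_div, eq_div_iff (pow_pos hqp0 _).ne']
    linarith [e3]
  -- `1 + r S = Σ_{i ≤ m+1} r^i`
  have hS' : 1 + r * S = ∑ i ∈ range (m + 2), r ^ i := by
    rw [Finset.sum_range_succ', pow_zero, Finset.mul_sum, add_comm]
    congr 1
    refine Finset.sum_congr rfl fun i _ => ?_
    rw [pow_succ]; ring
  have hAMGM := sq_mul_pow_lt_geom_sum_sq hr1 (m := m + 1) (by omega)
  rw [← hS'] at hAMGM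
  have hpos : 0 < 1 + r * S := by linarith [mul_pos hr0 hS0]
  clear_value r S
  clear hS' hS hr e1 e2 e3 haS hp hm hk
  have hc1 : ((m + 1 : ℕ) : ℝ) + 1 = (m : ℝ) + 2 := by push_cast; ring
  rw [hc1] at hAMGM
  have hc2 : ((m + 3 : ℕ) : ℝ) - 1 = (m : ℝ) + 2 := by push_cast; ring
  rw [hc2, hratio, hqm]
  have hfinal : ((m : ℝ) + 2) ^ 2 * (r ^ (m + 1) * (1 / (1 + r * S)) * (1 / (1 + r * S))) =
      (((m : ℝ) + 2) ^ 2 * r ^ (m + 1)) / (1 + r * S) ^ 2 := by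
    field_simp
  rw [hfinal, div_lt_one (by positivity)]
  exact hAMGM

/-- **Sly's extra condition `(d-1) q⁺ q⁻ < 1` holds for every `λ > λ_c(𝕋_d)`** (he assumes it in
(e:extraConditions), noting "the first can be shown to hold for all `λ > λ_c` with a somewhat involved
proof"): from `twoCycle_multiplier_lt_one` and `q⁺ q⁻ < 1`. [cite: Sly2010, §1.3 (eq. (e:extraConditions))] -/
theorem sly_extraCondition {d : ℕ} (hd : 3 ≤ d) {lam qp qm : ℝ} (hlam : 0 < lam) (hqm : 0 < qm)
    (hlt : qm < qp) (hqp : qp < 1) (hp : qp = hcPhi (d - 1) lam qm) (hm : qm = hcPhi (d - 1) lam qp) :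
    ((d : ℝ) - 1) * (qp * qm) < 1 := by
  have h := twoCycle_multiplier_lt_one hd hlam hlt hqp hp hm
  have hd1 : (1 : ℝ) ≤ (d : ℝ) - 1 := by
    have : (3 : ℝ) ≤ d := by exact_mod_cast hd
    linarith
  have hpq : 0 < qp * qm := mul_pos (hqm.trans hlt) hqm
  have hpq1 : qp * qm < 1 := by nlinarith
  have e : ((d : ℝ) - 1) ^ 2 * (qp * qm) - ((d : ℝ) - 1) * (qp * qm) =
      ((d : ℝ) - 1) * (((d : ℝ) - 1) - 1) * (qp * qm) := by ring
  have hnn : 0 ≤ ((d : ℝ) - 1) * (((d : ℝ) - 1) - 1) * (qp * qm) :=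
    mul_nonneg (mul_nonneg (by linarith) (by linarith)) hpq.le
  linarith

end Attraction

/-! #### Boundary fields with constant fugacity: generating sums and the mean root marginal -/

section Generating

variable {w : ℝ}

/-- The blocks identify leaf configurations of depth `L+1` with `q`-tuples of configurations of
depth `L`. [folklore] -/
noncomputable def hcBlockEquiv (q L : ℕ) : Fin q × Fin (q ^ L) ≃ Fin (q ^ (L + 1)) :=
  Equiv.ofBijective (fun p => hcBlock q L p.1 p.2)
    ((Fintype.bijective_iff_injective_and_card _).2
      ⟨fun p p' h => Prod.ext (hcBlock_injective2 h).1 (hcBlock_injective2 h).2, by simp [pow_succ']⟩)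

/-- `A ↦ (A|_{block c})_c` is a bijection. [folklore] -/
noncomputable def hcBlockConfigEquiv (q L : ℕ) (β : Type*) :
    (Fin (q ^ (L + 1)) → β) ≃ (Fin q → Fin (q ^ L) → β) :=
  ((hcBlockEquiv q L).symm.arrowCongr (Equiv.refl β)).trans (Equiv.curry _ _ _)

/-- `hcBlockConfigEquiv` is `hcBlockConfig`. [folklore] -/
theorem hcBlockConfigEquiv_apply {q L : ℕ} {β : Type*} (A : Fin (q ^ (L + 1)) → β) :
    hcBlockConfigEquiv q L β A = hcBlockConfig A := rfl

/-- The number of occupied leaves `|A|`. [folklore] -/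
def hcLeafCount {N : ℕ} (A : Fin N → Bool) : ℕ := (univ.filter fun u => A u = true).card

/-- `|A|` as a sum of indicators. [folklore] -/
theorem hcLeafCount_eq_sum {N : ℕ} (A : Fin N → Bool) :
    hcLeafCount A = ∑ u, if A u = true then 1 else 0 := by
  unfold hcLeafCount; rw [Finset.card_filter]

/-- Occupied leaves are counted block by block. [folklore] -/
theorem hcLeafCount_succ {q L : ℕ} (A : Fin (q ^ (L + 1)) → Bool) :
    hcLeafCount A = ∑ c : Fin q, hcLeafCount (hcBlockConfig A c) := by
  simp_rw [hcLeafCount_eq_sum]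
  unfold hcBlockConfig
  rw [sum_hcBlock (fun u => if A u = true then 1 else 0)]

/-- All leaves of the depth-`0` tree are the root. [folklore] -/
theorem fin_pow_zero_eq (q : ℕ) (u : Fin (q ^ 0)) : u = ⟨0, by simp⟩ :=
  Fin.ext (by
    have h1 : (u : ℕ) < q ^ 0 := u.isLt
    have h2 : q ^ 0 = 1 := pow_zero q
    simp only; omega)

/-- **Generating sums** `G_L(r) = Σ_A w^{|A|} Z_L(r, A)`: the partition function of the depth-`L`
tree with root state `r` and an i.i.d. boundary field of fugacity `w` on the leaves (for `w` the
two-cycle fugacities, the projection of the semi-translation-invariant measures `μ̂^{±}` — Sly's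
Lemma 4.3: "`P*` … restricted to an individual tree corresponds to the measure `μ̂⁺`").
[cite: Sly2010, §4.1 (Lemma 4.3 and the measure `P*`)] -/
noncomputable def hcGen (q : ℕ) (lam w : ℝ) (L : ℕ) (r : Bool) : ℝ :=
  ∑ A : Fin (q ^ L) → Bool, w ^ hcLeafCount A * hcTreeZ q lam L r A

/-- `G_0(1) = w`, `G_0(0) = 1`. [folklore] -/
theorem hcGen_zero (r : Bool) : hcGen q lam w 0 r = if r then w else 1 := by
  unfold hcGen
  rw [Fintype.sum_eq_single (fun _ => r)]
  · have hcount : hcLeafCount (fun _ : Fin (q ^ 0) => r) = if r then 1 else 0 := by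
      rw [hcLeafCount_eq_sum, Finset.sum_const, Finset.card_univ, Fintype.card_fin, pow_zero, one_nsmul]
    rw [hcTreeZ_zero, hcount]
    cases r <;> simp
  · intro A hA
    have hA0 : A ⟨0, by simp⟩ ≠ r := by
      intro h
      apply hA
      funext u
      rw [fin_pow_zero_eq q u]
      exact h
    rw [hcTreeZ_zero, if_neg hA0, mul_zero]

/-- Sums over leaf configurations of depth `L+1` of products over blocks factorise. [folklore] -/
theorem sum_prod_hcBlockConfig {q L : ℕ} (f : Fin q → (Fin (q ^ L) → Bool) → ℝ) :
    ∑ A : Fin (q ^ (L + 1)) → Bool, ∏ c, f c (hcBlockConfig A c) = ∏ c, ∑ B : Fin (q ^ L) → Bool, f c B := by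
  rw [← (hcBlockConfigEquiv q L Bool).symm.sum_comp]
  simp only [Equiv.apply_symm_apply, ← hcBlockConfigEquiv_apply]
  rw [Finset.prod_univ_sum]
  simp only [Fintype.piFinset_univ]

/-- `w^{|A|} = Π_c w^{|A|_c|}`. [folklore] -/
theorem pow_hcLeafCount_succ {q L : ℕ} (w : ℝ) (A : Fin (q ^ (L + 1)) → Bool) :
    w ^ hcLeafCount A = ∏ c : Fin q, w ^ hcLeafCount (hcBlockConfig A c) := by
  rw [hcLeafCount_succ, Finset.prod_pow_eq_pow_sum]

/-- **`G_{L+1}(1) = λ G_L(0)^q`.** [cite: Sly2010, §4 (tree recursions)] -/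
theorem hcGen_succ_true (L : ℕ) : hcGen q lam w (L + 1) true = lam * hcGen q lam w L false ^ q := by
  unfold hcGen
  simp_rw [hcTreeZ_succ_true, pow_hcLeafCount_succ]
  have : ∀ A : Fin (q ^ (L + 1)) → Bool,
      (∏ c : Fin q, w ^ hcLeafCount (hcBlockConfig A c)) * (lam * ∏ c, hcTreeZ q lam L false (hcBlockConfig A c)) =
        lam * ∏ c, (w ^ hcLeafCount (hcBlockConfig A c) * hcTreeZ q lam L false (hcBlockConfig A c)) := by
    intro A; rw [Finset.prod_mul_distrib]; ring
  simp_rw [this]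
  rw [← Finset.mul_sum, sum_prod_hcBlockConfig (fun _ B => w ^ hcLeafCount B * hcTreeZ q lam L false B),
    Finset.prod_const, Finset.card_univ, Fintype.card_fin]

/-- **`G_{L+1}(0) = (G_L(0) + G_L(1))^q`.** [cite: Sly2010, §4 (tree recursions)] -/
theorem hcGen_succ_false (L : ℕ) :
    hcGen q lam w (L + 1) false = (hcGen q lam w L false + hcGen q lam w L true) ^ q := by
  unfold hcGen
  simp_rw [hcTreeZ_succ_false, pow_hcLeafCount_succ, ← Finset.prod_mul_distrib]
  rw [sum_prod_hcBlockConfig (fun _ B => w ^ hcLeafCount B * hcTreeZtot q lam L B), Finset.prod_const,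
    Finset.card_univ, Fintype.card_fin, ← Finset.sum_add_distrib]
  congr 1
  refine Finset.sum_congr rfl fun B _ => ?_
  unfold hcTreeZtot; ring

/-- `G_L(r) ≥ 0`. [folklore] -/
theorem hcGen_nonneg (hlam : 0 ≤ lam) (hw : 0 ≤ w) (L : ℕ) (r : Bool) : 0 ≤ hcGen q lam w L r :=
  Finset.sum_nonneg fun A _ => mul_nonneg (pow_nonneg hw _) (hcTreeZ_nonneg hlam L r A)

/-- `G_L(0) + G_L(1) > 0`. [folklore] -/
theorem hcGen_tot_pos (hlam : 0 ≤ lam) (hw : 0 ≤ w) : ∀ L, 0 < hcGen q lam w L false + hcGen q lam w L true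
  | 0 => by rw [hcGen_zero, hcGen_zero]; simp; linarith
  | L + 1 => by
    rw [hcGen_succ_false]
    exact add_pos_of_pos_of_nonneg (pow_pos (hcGen_tot_pos hlam hw L) q) (hcGen_nonneg hlam hw _ _)

/-- The algebra of one step of the ratio recursion. [folklore] -/
theorem ratio_step_aux (q : ℕ) {lam a : ℝ} (hlam : 0 ≤ lam) (ha : 0 ≤ a) (b : ℝ) (hab : 0 < a + b) :
    lam * a ^ q / ((a + b) ^ q + lam * a ^ q) = lam * (1 - b / (a + b)) ^ q / (1 + lam * (1 - b / (a + b)) ^ q) := by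
  have h1 : 1 - b / (a + b) = a / (a + b) := by field_simp; ring
  rw [h1, div_pow]
  have hq : (a + b) ^ q ≠ 0 := (pow_pos hab q).ne'
  have h2 : (a + b) ^ q + lam * a ^ q ≠ 0 := by
    have : 0 < (a + b) ^ q + lam * a ^ q := add_pos_of_pos_of_nonneg (pow_pos hab q) (by positivity)
    exact this.ne'
  field_simp

/-- **The mean root marginal under the fugacity-`w` boundary field is an iterate of `φ`**:
`G_L(1)/(G_L(0) + G_L(1)) = φ^{L}(w/(1+w))`; with `w/(1+w) = q^{∓}` and `φ` swapping `q⁺, q⁻` it is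
exactly `q^{±}` (the root of a tree under `μ̂^{±}` is occupied with probability `q^{±}`).
[cite: Sly2010, §4.1 (Lemma 4.3); §1.3 (the densities `q^{±}`)] -/
theorem hcGen_ratio (hlam : 0 ≤ lam) (hw : 0 ≤ w) : ∀ L : ℕ,
    hcGen q lam w L true / (hcGen q lam w L false + hcGen q lam w L true) = (hcPhi q lam)^[L] (w / (1 + w))
  | 0 => by rw [hcGen_zero, hcGen_zero, Function.iterate_zero, id]; simp [add_comm]
  | L + 1 => by
    rw [Function.iterate_succ_apply', ← hcGen_ratio hlam hw L, hcPhi_eq, hcGen_succ_true, hcGen_succ_false]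
    exact ratio_step_aux q hlam (hcGen_nonneg hlam hw L false) _ (hcGen_tot_pos hlam hw L)

/-- **Mean absolute deviation from above**: on a finite probability space, a random variable
bounded above by `M` with mean `μ` has `E|Y - μ| ≤ 2(M - μ)`. [folklore] -/
theorem sum_abs_sub_mean_le {ι : Type*} (s : Finset ι) (p y : ι → ℝ) (hp : ∀ i ∈ s, 0 ≤ p i)
    (hsum : ∑ i ∈ s, p i = 1) {M : ℝ} (hy : ∀ i ∈ s, y i ≤ M) :
    ∑ i ∈ s, p i * |y i - ∑ j ∈ s, p j * y j| ≤ 2 * (M - ∑ j ∈ s, p j * y j) := by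
  set μ := ∑ j ∈ s, p j * y j with hμ
  have hdev : ∑ i ∈ s, p i * (y i - μ) = 0 := by
    simp_rw [mul_sub, Finset.sum_sub_distrib, ← Finset.sum_mul, hsum, one_mul, hμ, sub_self]
  have hpt : ∀ i ∈ s, p i * |y i - μ| ≤ p i * (2 * (M - μ) - (y i - μ)) := by
    intro i hi
    refine mul_le_mul_of_nonneg_left ?_ (hp i hi)
    have := hy i hi
    rcases le_total 0 (y i - μ) with h | h
    · rw [abs_of_nonneg h]; linarith
    · rw [abs_of_nonpos h]
      have hμM : μ ≤ M := by
        calc μ = ∑ j ∈ s, p j * y j := rfl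
          _ ≤ ∑ j ∈ s, p j * M := Finset.sum_le_sum fun j hj => mul_le_mul_of_nonneg_left (hy j hj) (hp j hj)
          _ = M := by rw [← Finset.sum_mul, hsum, one_mul]
      linarith
  calc ∑ i ∈ s, p i * |y i - μ| ≤ ∑ i ∈ s, p i * (2 * (M - μ) - (y i - μ)) := Finset.sum_le_sum hpt
    _ = 2 * (M - μ) * ∑ i ∈ s, p i - ∑ i ∈ s, p i * (y i - μ) := by
        rw [Finset.mul_sum, ← Finset.sum_sub_distrib]
        refine Finset.sum_congr rfl fun i _ => ?_; ring
    _ = 2 * (M - μ) := by rw [hsum, hdev]; ring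

/-- **Non-reconstruction bound, finite form**: under the fugacity-`w` boundary field
`ν(A) ∝ w^{|A|} Z_L(A)`, the root marginal given the leaves `X_L(A)` has mean `R_L = φ^L(w/(1+w))`
(`hcGen_ratio`) and, being at most the extreme-boundary value `M_L` for every `A`, deviates from its
mean by at most `2(M_L - R_L)` in `L¹(ν)` — the input `E|X_{v,ℓ,s} - q| → 0` of Sly's (e:treeReconDecay2),
here from the sandwich instead of extremality. [cite: Sly2010, §4 (eq. (e:treeReconDecay2), (e:extremalConvergence))] -/
theorem hcTreeX_meanAbsDev_le (hlam : 0 ≤ lam) (hw : 0 ≤ w) (L : ℕ) :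
    (∑ A : Fin (q ^ L) → Bool, w ^ hcLeafCount A * hcTreeZtot q lam L A *
        |hcTreeX q lam L A - (hcPhi q lam)^[L] (w / (1 + w))|) /
        (hcGen q lam w L false + hcGen q lam w L true) ≤
      2 * (hcM q lam L - (hcPhi q lam)^[L] (w / (1 + w))) := by
  have hT := hcGen_tot_pos hlam hw L (q := q)
  set T := hcGen q lam w L false + hcGen q lam w L true with hTdef
  -- probability weights and values
  set p : (Fin (q ^ L) → Bool) → ℝ := fun A => w ^ hcLeafCount A * hcTreeZtot q lam L A / T with hpdef
  have hp0 : ∀ A, 0 ≤ p A := fun A => div_nonneg (mul_nonneg (pow_nonneg hw _) (hcTreeZtot_pos hlam L A).le) hT.le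
  have hpsum : ∑ A, p A = 1 := by
    simp only [hpdef, ← Finset.sum_div]
    rw [div_eq_one_iff_eq hT.ne', hTdef]
    unfold hcGen
    rw [← Finset.sum_add_distrib]
    refine Finset.sum_congr rfl fun A _ => ?_
    unfold hcTreeZtot; ring
  have hmean : ∑ A, p A * hcTreeX q lam L A = (hcPhi q lam)^[L] (w / (1 + w)) := by
    rw [← hcGen_ratio hlam hw L, hTdef.symm] at *
    simp only [hpdef]
    rw [show (∑ A, w ^ hcLeafCount A * hcTreeZtot q lam L A / T * hcTreeX q lam L A) =
      (∑ A, w ^ hcLeafCount A * hcTreeZ q lam L true A) / T from ?_]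
    · rfl
    rw [Finset.sum_div]
    refine Finset.sum_congr rfl fun A _ => ?_
    have hZ := hcTreeZtot_pos hlam L A (q := q)
    unfold hcTreeX
    field_simp
  have hbound : ∀ A, hcTreeX q lam L A ≤ hcM q lam L := by
    intro A
    have h := hcIter_mem_env hlam le_rfl zero_le_one le_rfl L (fun u => if A u then (1 : ℝ) else 0)
      fun u => by split_ifs <;> exact ⟨by norm_num, by norm_num⟩
    rw [← hcTreeX_eq_hcIter hlam] at h
    exact h.2
  have key := sum_abs_sub_mean_le univ p (fun A => hcTreeX q lam L A) (fun A _ => hp0 A) hpsum fun A _ => hbound A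
  rw [hmean] at key
  refine le_trans (le_of_eq ?_) key
  rw [Finset.sum_div]
  refine Finset.sum_congr rfl fun A _ => ?_
  simp only [hpdef]
  ring

end Generating

/-! #### Vocabulary for Part II/III: logits, the subtree split, window Lipschitz constants -/

section PartTwoVocab

/-- The logit `log(x/(1-x))` (log of the hard-core "ratio" `R = x/(1-x)`). [folklore] -/
noncomputable def hcLogit (x : ℝ) : ℝ := Real.log (x / (1 - x))

/-- `logit x = log x - log(1-x)` on `(0,1)`. [folklore] -/
theorem hcLogit_eq {x : ℝ} (hx0 : 0 < x) (hx1 : x < 1) : hcLogit x = Real.log x - Real.log (1 - x) := by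
  unfold hcLogit; rw [Real.log_div hx0.ne' (by linarith)]


/-- The leaves of the depth-`K+L` tree, subtree by subtree: `(u, j) ↦ u q^K + j`. [folklore] -/
theorem hcSub_injective2 {q K L : ℕ} {u u' : Fin (q ^ L)} {j j' : Fin (q ^ K)}
    (h : (⟨u * q ^ K + j, by
      have hj := j.isLt; have hu := u.isLt
      calc (u : ℕ) * q ^ K + j < u * q ^ K + q ^ K := by omega
        _ = (u + 1) * q ^ K := by ring
        _ ≤ q ^ L * q ^ K := Nat.mul_le_mul_right _ hu
        _ = q ^ (K + L) := by rw [pow_add, mul_comm]⟩ : Fin (q ^ (K + L))) =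
      ⟨u' * q ^ K + j', by
      have hj := j'.isLt; have hu := u'.isLt
      calc (u' : ℕ) * q ^ K + j' < u' * q ^ K + q ^ K := by omega
        _ = (u' + 1) * q ^ K := by ring
        _ ≤ q ^ L * q ^ K := Nat.mul_le_mul_right _ hu
        _ = q ^ (K + L) := by rw [pow_add, mul_comm]⟩) : u = u' ∧ j = j' := by
  rcases Nat.eq_zero_or_pos q with rfl | hq
  · rcases Nat.eq_zero_or_pos K with rfl | hK
    · have hj := j.isLt; have hj' := j'.isLt
      simp only [pow_zero, Nat.lt_one_iff] at hj hj'
      have hv := congrArg Fin.val h; simp only [pow_zero, mul_one] at hv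
      exact ⟨Fin.ext (by omega), Fin.ext (by omega)⟩
    · exfalso
      have h1 : (j : ℕ) < 0 ^ K := j.isLt
      have h2 : (0 : ℕ) ^ K = 0 := zero_pow hK.ne'
      omega
  have hqK : 0 < q ^ K := pow_pos hq K
  have hv : (u : ℕ) * q ^ K + j = u' * q ^ K + j' := by have := congrArg Fin.val h; simpa using this
  have hj := j.isLt; have hj' := j'.isLt
  have hu : (u : ℕ) = u' := by
    have h1 : ((u : ℕ) * q ^ K + j) / q ^ K = u := by
      rw [add_comm, Nat.add_mul_div_right _ _ hqK, Nat.div_eq_of_lt hj, zero_add]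
    have h2 : ((u' : ℕ) * q ^ K + j') / q ^ K = u' := by
      rw [add_comm, Nat.add_mul_div_right _ _ hqK, Nat.div_eq_of_lt hj', zero_add]
    rw [← h1, ← h2, hv]
  refine ⟨Fin.ext hu, Fin.ext ?_⟩
  rw [hu] at hv; omega

/-- The subtree decomposition of the leaves is a bijection `Fin (q^L) × Fin (q^K) ≃ Fin (q^{K+L})`. [folklore] -/
noncomputable def hcSubEquiv (q K L : ℕ) : Fin (q ^ L) × Fin (q ^ K) ≃ Fin (q ^ (K + L)) :=
  Equiv.ofBijective (fun p => (⟨p.1 * q ^ K + p.2, by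
      have hj := p.2.isLt; have hu := p.1.isLt
      calc (p.1 : ℕ) * q ^ K + p.2 < p.1 * q ^ K + q ^ K := by omega
        _ = (p.1 + 1) * q ^ K := by ring
        _ ≤ q ^ L * q ^ K := Nat.mul_le_mul_right _ hu
        _ = q ^ (K + L) := by rw [pow_add, mul_comm]⟩ : Fin (q ^ (K + L))))
    ((Fintype.bijective_iff_injective_and_card _).2
      ⟨fun p p' h => Prod.ext (hcSub_injective2 h).1 (hcSub_injective2 h).2,
        by simp [pow_add, mul_comm]⟩)

/-- Unfolding `hcSubEquiv` against `hcSubConfig`. [folklore] -/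
theorem hcSubEquiv_apply_eq {q K L : ℕ} {β : Type*} (A : Fin (q ^ (K + L)) → β) (u : Fin (q ^ L)) (j : Fin (q ^ K)) :
    A (hcSubEquiv q K L (u, j)) = hcSubConfig A u j := rfl

/-- `A ↦ (A|_{subtree u})_u` is a bijection. [folklore] -/
noncomputable def hcSubConfigEquiv (q K L : ℕ) (β : Type*) :
    (Fin (q ^ (K + L)) → β) ≃ (Fin (q ^ L) → Fin (q ^ K) → β) :=
  ((hcSubEquiv q K L).symm.arrowCongr (Equiv.refl β)).trans (Equiv.curry _ _ _)

/-- `hcSubConfigEquiv` is `hcSubConfig`. [folklore] -/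
theorem hcSubConfigEquiv_apply {q K L : ℕ} {β : Type*} (A : Fin (q ^ (K + L)) → β) :
    hcSubConfigEquiv q K L β A = hcSubConfig A := rfl

/-- Sums over leaf configurations of products over subtrees factorise. [folklore] -/
theorem sum_prod_hcSubConfig {q K L : ℕ} (f : Fin (q ^ L) → (Fin (q ^ K) → Bool) → ℝ) :
    ∑ A : Fin (q ^ (K + L)) → Bool, ∏ u, f u (hcSubConfig A u) = ∏ u, ∑ B : Fin (q ^ K) → Bool, f u B := by
  rw [← (hcSubConfigEquiv q K L Bool).symm.sum_comp]
  simp only [Equiv.apply_symm_apply, ← hcSubConfigEquiv_apply]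
  rw [Finset.prod_univ_sum]
  simp only [Fintype.piFinset_univ]

/-- Sums over the leaves subtree by subtree. [folklore] -/
theorem sum_hcSub {q K L : ℕ} {M : Type*} [AddCommMonoid M] (f : Fin (q ^ (K + L)) → M) :
    ∑ u : Fin (q ^ L), ∑ j : Fin (q ^ K), f (hcSubEquiv q K L (u, j)) = ∑ v, f v := by
  rw [← Fintype.sum_prod_type']
  exact Fintype.sum_bijective _ (hcSubEquiv q K L).bijective _ _ fun _ => rfl

/-- Occupied leaves are counted subtree by subtree. [folklore] -/
theorem hcLeafCount_sub {q K L : ℕ} (A : Fin (q ^ (K + L)) → Bool) :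
    hcLeafCount A = ∑ u : Fin (q ^ L), hcLeafCount (hcSubConfig A u) := by
  simp_rw [hcLeafCount_eq_sum]
  rw [← sum_hcSub (fun v => if A v = true then 1 else 0)]
  rfl


variable (q lam) in
/-- The window Lipschitz constant `Λ(a,b) = λ q (1-a)^{q-1}/(1+λ(1-b)^q)²` of `hcPhi_lipschitz_on`. [folklore] -/
noncomputable def hcΛ (a b : ℝ) : ℝ := lam * q * (1 - a) ^ (q - 1) / (1 + lam * (1 - b) ^ q) ^ 2

/-- Unfolding lemma for `hcΛ`. [folklore] -/
theorem hcΛ_def (a b : ℝ) : hcΛ q lam a b = lam * q * (1 - a) ^ (q - 1) / (1 + lam * (1 - b) ^ q) ^ 2 := rfl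

/-- At a point of the two-cycle the window constant is the derivative: `Λ(y,y) = q φ(y)(1-φ(y))/(1-y)`. [folklore] -/
theorem hcΛ_diag (hq : 1 ≤ q) {y : ℝ} (hy : y < 1) :
    hcΛ q lam y y = q * hcPhi q lam y * (1 - hcPhi q lam y) / (1 - y) := by
  rw [hcΛ_def, hcPhi_eq]
  obtain ⟨k, rfl⟩ : ∃ k, q = k + 1 := ⟨q - 1, by omega⟩
  rw [show k + 1 - 1 = k from rfl]
  have h1 : (1 - y) ≠ 0 := by linarith
  by_cases hden : (1 + lam * (1 - y) ^ (k + 1)) = 0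
  · -- degenerate (only for negative `λ`): both sides vanish
    simp [hden]
  push_cast
  field_simp
  ring

end PartTwoVocab

end TreeRecursion

end Literature.Computability.Complexity
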